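/-
Copyright (c) 2026. All rights reserved.
Released under Apache 2.0 license as described in the file LICENSE.
-/
import Literature.NumberTheory.ComplexMultiplication.DegenerateCMTypesCyclicTwoOddPrimes
import Literature.NumberTheory.ComplexMultiplication.DegenerateCMTypesCompositeDimension
import HarnessLib

/-!
# The CM types of the abelian group `⟨ρ⟩ × (ℤ/p)²` and their ranks: Dodson's second minimal group of
# degree `9` (`⟨ρ⟩ × ℤ₃²`: ranks `10, 8, 4, 2`) for every odd prime `p` — group level

B. Dodson, *On the Mumford–Tate group of an abelian variety with complex multiplication*, J. Algebra **111**
(1987) 49–73 [Dodson1987] (held text `paper:doi-10-1016-0021-8693-87-90242-0`, §4 pp. 69–71 = p0021–p0023),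
computes the ranks of the CM types on the two "minimal groups" `⟨ρ⟩ × R₀` of degree `9`, `R₀ ∈ {ℤ₉, ℤ₃²}` ("the
two regular groups of degree `9`"):

> EXAMPLE 4.3. "When `n = 9` and `R₀ = ℤ₃²`, we have Aut(`ℤ₃²`) `= GL(2,3)` … we take `ℤ₃²` to be explicitly given
> as the group generated by `(123)(456)(789)` and `(147)(258)(369)`."
> PROPOSITION 4.1. "Let `f ∈ ℤ₂⁹` define a type on `⟨ρ⟩ × R₀`, for `R₀` one of the two regular groups of degree
> `9`. Then the type defined by `f` is nondegenerate whenever weight(`f`) is relatively prime to `3`."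
> PROPOSITION 4.4. "(2) Suppose `R₀ = ℤ₃²` and weight(`f`) `= 3`. Then there are the following cases: (a) the
> orbits of order `9` give types with rank(`f`) `= 8` and (b) there are twelve `f` in four `ℤ₃²`-orbits of order
> `3`. […] *Proof.* (2) There is a single Hol(`ℤ₃²`)-orbit of `ℤ₃²`-orbits of order `9`, whose types have rank `8`.
> The four `ℤ₃²`-orbits of order `3` correspond to the four subgroups isomorphic to `ℤ₃` in `ℤ₃²`, and the ranks
> for the union of these orbits may then be checked directly."

(`⟨ρ⟩ × ℤ₃²` is the Galois group of every CM field `kK₀` with `k` imaginary quadratic and `K₀` totally real with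
group `ℤ₃²`, e.g. `ℚ(√-d, ζ₇ + ζ₇⁻¹, ζ₉ + ζ₉⁻¹)`; the companion file `DegenerateCMTypesCyclicPrimeSquare` treats
`R₀ = ℤ_{p²}`, i.e. Prop. 4.4 (1).)  Dodson's proofs are "explicit calculations" on orbit representatives.  This
file PROVES the rank of EVERY CM type of `⟨ρ⟩ × (ℤ/p)²` for EVERY odd prime `p`, by T. Kubota's Lemma 2
[Kubota1965] (`rank = p² + 1 −` the number of odd characters vanishing on the type; tree
`IsCMTypeWith.typeRank_add_ncard_oddCharacters_vanishing`) and the character method of F. Hazama, *Hodge cycles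
on abelian varieties with complex multiplication by cyclic CM-fields*, J. Math. Sci. Univ. Tokyo **10** (2003)
[Hazama2003CyclicCM] (Prop. 4.1: the character sum of a type in coordinates; Prop. 4.3: a character of order
`2p` trivial on `⟨τ⟩` vanishes iff the `(0,1)`-matrix of the type has constant row sums), whose vocabulary
(`pairSum`, `signMatrix`, `rowCount`, `HasConstantRows`, `IsStableUnder` of the tree's
`DegenerateCMTypesCyclicTwoOddPrimes`) is used VERBATIM with `q = p` and a frame `(τ, κ)` of `(ℤ/p)²`.

THE MECHANISM.  Every odd character `χ ≠ sgn` of `⟨ρ⟩ × (ℤ/p)²` has order `2p` and its kernel in `(ℤ/p)²` is one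
of the `p + 1` subgroups `H` of order `p`; `χ(S) = Σ_{cosets c of H} (2·#(S ∩ c) − p)·ψ(c)` with `ψ` a faithful
character of `(ℤ/p)²/H ≅ ℤ/p`, so (`Φ_p` is the only rational relation among the `p`-th roots of unity) `χ(S) = 0`
iff `S` is EQUIDISTRIBUTED over the `p` cosets of `H`; each `H` is the kernel of exactly `p − 1` odd characters.
Hence `rank(S) = p² + 1 − (p − 1)·t(S)`, `t(S) = #{H : S equidistributed over (ℤ/p)²/H}`.

## Setting and dictionary (as in `CMTypeRank.lean`, `DegenerateCMTypesCyclicTwoOddPrimes.lean`)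

`G` is a finite commutative group acting on itself, `p` an odd prime (`[Fact p.Prime]`, `hp2 : p ≠ 2`), `τ, κ ∈ G`
of order `p` with `κ ∉ ⟨τ⟩` (a FRAME of the elementary abelian subgroup), `|G| = 2p²` (`hτ`, `hκ`, `hτκ`, `hcard`);
`Φ : Finset G` is a CM type for `ρ` (`IsCMTypeWith ρ Φ`, forcing `ρ² = 1 ≠ ρ`, so `G = ⟨ρ⟩ × ⟨τ⟩ × ⟨κ⟩`,
`coord_bijective`); the rank is the Kubota–Dodson `typeRank G Φ` (nondegenerate iff `= p² + 1`).  The `p + 1`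
subgroups of order `p` are `⟨τ⟩` and `⟨τʲκ⟩`, `j ∈ ℤ/p` (`frame_change`: `(τʲκ, τ)` is again a frame), and
* "`S` is equidistributed over the cosets `κʸ⟨τ⟩` of `⟨τ⟩`" is `HasConstantRows p p S τ κ` (constant row counts
  `#{x : τˣκʸ ∈ S}` of the `p × p` `(0,1)`-matrix of `S`);
* "`S` is equidistributed over the cosets `τᵗ⟨τʲκ⟩`" is `HasConstantRows p p S (τʲκ) τ` (row counts
  `#{y : (τʲκ)ʸτᵗ ∈ S} = #{y : τ^{jy+t}κʸ ∈ S}`, `rowCount_diag` — the lines of slope `j`);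
* "imprimitive" is `∃ u ≠ 1, IsStableUnder S u`, which happens iff `τ` or some `τʲκ` stabilises `S`
  (`exists_isStableUnder_iff`) — Dodson: the `ℤ₃²`-orbit of `f` has order `3`.

## What is PROVED (theorems only; no definition, no named fact, no `sorry`)

* §1 the frame: `pow_mul_pow_injective`, **`coord_bijective`**, `exists_coord`, **`frame_change`**, `frame_swap`,
  `diag_coord` (`(τʲκ)ʸτᵗ = τ^{jy+t}κʸ`).
* §2 **`sum_char_eq_pairSum`** (`χ(S) = V(E(S); χ(τ), χ(κ))` for odd `χ`); the kinds of odd characters: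
  `sum_char_ne_zero_of_apply_eq_one` (`χ(τ) = χ(κ) = 1`: never vanishes, `p²` odd);
  **`sum_char_eq_zero_iff_hasConstantRows`** (`χ(τ) = 1 ≠ χ(κ)`: vanishes iff constant counts on the cosets of
  `⟨τ⟩`); **`sum_char_eq_zero_iff_hasConstantRows_diag`** (`χ(τ) ≠ 1`, `χ(τʲκ) = 1`: iff constant counts on the
  cosets of `⟨τʲκ⟩`); `existsUnique_diag` (the `j`).
* §3 `ncard_oddChar_class` (each subgroup of order `p` is the kernel of exactly `p − 1` odd characters),
  `sum_char_eq_zero_iff` (all odd `χ` at once), **`ncard_oddChar_vanishing_eq`**: the defect is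
  `(p − 1)·([⟨τ⟩-equidistributed] + #{j : ⟨τʲκ⟩-equidistributed})`.
* §4 THE RANKS: **`typeRank_add_defect_eq`** (`rank + (p − 1)·t = p² + 1`), **`typeRank_eq_iff`** /
  `typeRank_ne_iff` (nondegenerate iff equidistributed in NO direction), `typeRank_eq_of_unique_direction`
  (exactly one direction: `rank = (p − 1)p + 2`).
* §5 STABILISERS: `isStableUnder_iff_coord`, `hasConstantRows_diag_of_isStableUnder`,
  `hasConstantRows_of_isStableUnder_diag`, `hasConstantRows_diag_of_isStableUnder_diag` (a type stable under one
  subgroup of order `p` is equidistributed over the cosets of the `p` others), **`exists_isStableUnder_iff`**,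
  `forall_not_isStableUnder_iff`, **`typeRank_add_eq_of_isStableUnder`**, `typeRank_add_eq_of_isStableUnder_diag`,
  **`typeRank_eq_or_of_exists_isStableUnder`** (imprimitive types have rank `p + 1` or `2`).
* §6 WEIGHTS: `card_filter_diag_eq`, `not_hasConstantRows_of_not_dvd`, `not_hasConstantRows_diag_of_not_dvd`,
  **`typeRank_eq_of_not_dvd`** = PROP. 4.1 for `R₀ = ℤₚ²` with the exact rank and WITHOUT a primitivity
  hypothesis (weight prime to `p` ⟹ `rank = p² + 1`).
* §7 `p = 3` AS PRINTED (`τ, κ` of order `3`, `|G| = 18`): **`typeRank_add_defect_eq_nine`** (`rank + 2t = 10`),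
  **`typeRank_eq_eight_of_unique_direction`** (Prop. 4.4 (2)(a): one direction ⟹ rank `8`),
  `typeRank_eq_ten_iff`, **`typeRank_eq_ten_of_not_dvd`** (Prop. 4.1), **`typeRank_eq_or_of_exists_isStableUnder_nine`**
  (the orbits of order `3`: ranks `4`, `2`).

NOT here (sequels): for `p = 3`, that a PRIMITIVE type is equidistributed in AT MOST one direction (so the
primitive ranks are exactly `10`, `8`, and a weight-`3` type which is not a coset has `t = 1`: Prop. 4.4 (2)(a) for
every weight-`3` orbit of order `9`), the rank-`6` unions of (2)(b) (which need `G₀ ⊋ R₀`, Prop. 1.2 / 4.6),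
Lemma 4.2 (Hol(`R₀`)-invariance), Remark 4.5, the counts of the types in each class, and the number-field dress.

## References

* [Dodson1987] B. Dodson, J. Algebra 111 (1987) 49–73: §4.1 Prop. 4.1 (with proof), Example 4.3, Prop. 4.4 (2)
  (with proof); §4.2 Remark 4.7 (pp. 69–71).
* [Hazama2003CyclicCM] F. Hazama, J. Math. Sci. Univ. Tokyo 10 (2003) 581–598: Prop. 2.3, Prop. 4.1 and (4.1),
  Prop. 4.2, Prop. 4.3 ((4.4)–(4.5)), Lemma 4.6.1 ((4.7)).
* [Kubota1965] T. Kubota, Trans. AMS 118 (1965), §4 Lemma 2.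
* [Gordon1999HodgeAVSurvey] B. B. Gordon, *A survey of the Hodge conjecture for abelian varieties*, 9.4.1, 9.4.3.

## Provenance

Lane `lit-hodgefound` (Track 2, Layer A3 — CM types), seat `lit-hodgefound-p10` generation 35, row g35-#4;
neighbours cited by name, nothing restated: `DegenerateCMTypesCyclicTwoOddPrimes` (`pairSum`, `signMatrix`,
`rowCount`, `HasConstantRows`, `IsStableUnder`, `pairSum_one_left_eq_zero_iff`, `sum_rowCount_eq`),
`DegenerateCMTypesCompositeDimension` (`Dodson1984.ncard_oddChar`), `CMTypeRankCharacters` (Kubota's Lemma 2),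
`DegenerateCMTypesCyclicPrimeSquare` (the companion `R₀ = ℤ_{p²}`).
-/

set_option autoImplicit false

noncomputable section

open scoped BigOperators

namespace Literature.NumberTheory.ComplexMultiplication

namespace CyclicCMType

namespace ElemSq

/-! ## §1 The group `⟨ρ⟩ × (ℤ/p)²` in a frame `(τ, κ)`: coordinates `(x, y) ↦ τˣκʸ` -/

section Frame

variable {G : Type*} [CommGroup G] [Fintype G] {p : ℕ} [hp : Fact p.Prime] {ρ τ κ : G}

omit [Fintype G] in
/-- In `⟨τ⟩ × ⟨κ⟩ ≅ (ℤ/p)²` (`τ, κ` of order `p`, `κ ∉ ⟨τ⟩`): `τᵃκᵇ = 1` only if `p ∣ a` and `p ∣ b`. [folklore] -/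
private theorem dvd_of_pow_mul_pow_eq_one (hτ : orderOf τ = p) (hκ : orderOf κ = p)
    (hτκ : κ ∉ Subgroup.zpowers τ) {a b : ℕ} (h : τ ^ a * κ ^ b = 1) : p ∣ a ∧ p ∣ b := by
  have hb : p ∣ b := by
    by_contra hnd
    have hco : b.Coprime (orderOf κ) := by
      rw [hκ]; exact (Nat.coprime_comm.1 ((Nat.Prime.coprime_iff_not_dvd hp.out).2 hnd))
    obtain ⟨m, hm⟩ := exists_pow_eq_self_of_coprime hco
    apply hτκ
    have hkb : κ ^ b = (τ ^ a)⁻¹ := eq_inv_of_mul_eq_one_right h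
    rw [← hm, hkb, inv_pow]
    exact inv_mem (pow_mem (pow_mem (Subgroup.mem_zpowers τ) a) m)
  have hκb : κ ^ b = 1 := orderOf_dvd_iff_pow_eq_one.1 (hκ ▸ hb)
  rw [hκb, mul_one] at h
  exact ⟨hτ ▸ orderOf_dvd_of_pow_eq_one h, hb⟩

omit [Fintype G] in
/-- `τ^{x.val} τ^{(-x).val} = 1` for `τ` of order `p` and `x ∈ ℤ/p`. [folklore] -/
private theorem pow_val_mul_pow_neg_val (hτ : orderOf τ = p) (x : ZMod p) :
    τ ^ x.val * τ ^ (-x).val = 1 := by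
  haveI : NeZero p := ⟨hp.out.ne_zero⟩
  rw [← pow_add, ← orderOf_dvd_iff_pow_eq_one, hτ, ← ZMod.natCast_eq_zero_iff]
  push_cast
  rw [ZMod.natCast_zmod_val, ZMod.natCast_zmod_val, add_neg_cancel]

omit [Fintype G] in
/-- **`(x, y) ↦ τˣκʸ` is injective on `ℤ/p × ℤ/p`** (the regular elementary abelian group `ℤₚ × ℤₚ` of degree `p²`,
Dodson's `R₀ = ℤ₃²` "generated by `(123)(456)(789)` and `(147)(258)(369)`"). [cite: Dodson1987, Example 4.3] -/
theorem pow_mul_pow_injective (hτ : orderOf τ = p) (hκ : orderOf κ = p) (hτκ : κ ∉ Subgroup.zpowers τ) :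
    Function.Injective fun xy : ZMod p × ZMod p => τ ^ xy.1.val * κ ^ xy.2.val := by
  haveI : NeZero p := ⟨hp.out.ne_zero⟩
  rintro ⟨x, y⟩ ⟨x', y'⟩ h
  simp only at h
  have h1 : τ ^ (x.val + (-x').val) * κ ^ (y.val + (-y').val) = 1 := by
    calc τ ^ (x.val + (-x').val) * κ ^ (y.val + (-y').val)
        = τ ^ x.val * κ ^ y.val * (τ ^ (-x').val * κ ^ (-y').val) := by rw [pow_add, pow_add]; ac_rfl
      _ = τ ^ x'.val * κ ^ y'.val * (τ ^ (-x').val * κ ^ (-y').val) := by rw [h]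
      _ = (τ ^ x'.val * τ ^ (-x').val) * (κ ^ y'.val * κ ^ (-y').val) := by ac_rfl
      _ = 1 := by rw [pow_val_mul_pow_neg_val hτ, pow_val_mul_pow_neg_val hκ, mul_one]
  obtain ⟨hx, hy⟩ := dvd_of_pow_mul_pow_eq_one hτ hκ hτκ h1
  rw [← ZMod.natCast_eq_zero_iff] at hx hy
  push_cast at hx hy
  rw [ZMod.natCast_zmod_val, ZMod.natCast_zmod_val, add_neg_eq_zero] at hx hy
  rw [hx, hy]

omit [Fintype G] in
/-- `ρ ∉ ⟨τ, κ⟩`: an element with `ρ² = 1 ≠ ρ` is not of the form `τᵃκᵇ` (whose order divides the odd prime `p`).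
[folklore] -/
private theorem pow_mul_pow_ne_rho_mul (hp2 : p ≠ 2) (hτ : orderOf τ = p) (hκ : orderOf κ = p)
    (hρ1 : ρ ≠ 1) (hρ2 : ρ * ρ = 1) (a b c d : ℕ) : τ ^ a * κ ^ b ≠ ρ * (τ ^ c * κ ^ d) := by
  intro h
  -- `ρ = τ^{a + c(p-1)} κ^{b + d(p-1)}`, an element killed by `p`
  have hτp : τ ^ p = 1 := by rw [← hτ]; exact pow_orderOf_eq_one τ
  have hκp : κ ^ p = 1 := by rw [← hκ]; exact pow_orderOf_eq_one κ
  have hp1 : 1 ≤ p := hp.out.one_lt.le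
  have hinvτ : τ ^ c * τ ^ (c * (p - 1)) = 1 := by
    rw [← pow_add, show c + c * (p - 1) = c * p by
      rw [Nat.mul_sub, mul_one, ← Nat.add_sub_assoc (Nat.le_mul_of_pos_right c hp.out.pos)]; omega,
      pow_mul', hτp, one_pow]
  have hinvκ : κ ^ d * κ ^ (d * (p - 1)) = 1 := by
    rw [← pow_add, show d + d * (p - 1) = d * p by
      rw [Nat.mul_sub, mul_one, ← Nat.add_sub_assoc (Nat.le_mul_of_pos_right d hp.out.pos)]; omega,
      pow_mul', hκp, one_pow]
  have hρeq : ρ = τ ^ (a + c * (p - 1)) * κ ^ (b + d * (p - 1)) := by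
    calc ρ = ρ * (τ ^ c * κ ^ d) * (τ ^ (c * (p - 1)) * κ ^ (d * (p - 1))) := by
            rw [mul_assoc, mul_mul_mul_comm, hinvτ, hinvκ, mul_one, mul_one]
      _ = τ ^ a * κ ^ b * (τ ^ (c * (p - 1)) * κ ^ (d * (p - 1))) := by rw [← h]
      _ = τ ^ (a + c * (p - 1)) * κ ^ (b + d * (p - 1)) := by rw [pow_add, pow_add]; ac_rfl
  have hρp : ρ ^ p = 1 := by
    rw [hρeq, mul_pow, ← pow_mul, ← pow_mul, pow_mul', hτp, one_pow, pow_mul', hκp, one_pow, mul_one]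
  obtain ⟨k, hk⟩ := hp.out.odd_of_ne_two hp2
  have hρsq : ρ ^ 2 = 1 := by rw [sq, hρ2]
  apply hρ1
  rw [hk, pow_succ, pow_mul, hρsq, one_pow, one_mul] at hρp
  exact hρp

/-- **The coordinates of `G = ⟨ρ⟩ × ⟨τ⟩ × ⟨κ⟩`**: `(x, y) ↦ τˣκʸ` together with `(x, y) ↦ ρτˣκʸ` is a bijection
`(ℤ/p × ℤ/p) ⊔ (ℤ/p × ℤ/p) → G` (Dodson's minimal group `⟨ρ⟩ × R₀` with `R₀ = ℤ₃²`). [cite: Dodson1987, §4.1 and Example 4.3] -/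
theorem coord_bijective (hp2 : p ≠ 2) (hτ : orderOf τ = p) (hκ : orderOf κ = p)
    (hτκ : κ ∉ Subgroup.zpowers τ) (hcard : Fintype.card G = 2 * p ^ 2) (hρ1 : ρ ≠ 1) (hρ2 : ρ * ρ = 1) :
    Function.Bijective fun s : (ZMod p × ZMod p) ⊕ (ZMod p × ZMod p) =>
      Sum.elim (fun xy => τ ^ xy.1.val * κ ^ xy.2.val) (fun xy => ρ * (τ ^ xy.1.val * κ ^ xy.2.val)) s := by
  haveI : NeZero p := ⟨hp.out.ne_zero⟩
  rw [Fintype.bijective_iff_injective_and_card]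
  refine ⟨?_, by rw [Fintype.card_sum, Fintype.card_prod, ZMod.card, hcard, sq, two_mul]⟩
  rintro (a | a) (b | b) hab <;> simp only [Sum.elim_inl, Sum.elim_inr] at hab
  · exact congrArg Sum.inl (pow_mul_pow_injective hτ hκ hτκ hab)
  · exact absurd hab (pow_mul_pow_ne_rho_mul hp2 hτ hκ hρ1 hρ2 _ _ _ _)
  · exact absurd hab.symm (pow_mul_pow_ne_rho_mul hp2 hτ hκ hρ1 hρ2 _ _ _ _)
  · exact congrArg Sum.inr (pow_mul_pow_injective hτ hκ hτκ (mul_left_cancel hab))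

/-- Every `g ∈ G` is `τˣκʸ` or `ρτˣκʸ` with `x, y ∈ ℤ/p`. [cite: Dodson1987, §4.1 and Example 4.3] -/
theorem exists_coord (hp2 : p ≠ 2) (hτ : orderOf τ = p) (hκ : orderOf κ = p)
    (hτκ : κ ∉ Subgroup.zpowers τ) (hcard : Fintype.card G = 2 * p ^ 2) (hρ1 : ρ ≠ 1) (hρ2 : ρ * ρ = 1)
    (g : G) :
    ∃ xy : ZMod p × ZMod p, g = τ ^ xy.1.val * κ ^ xy.2.val ∨ g = ρ * (τ ^ xy.1.val * κ ^ xy.2.val) := by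
  obtain ⟨s, h⟩ := (coord_bijective hp2 hτ hκ hτκ hcard hρ1 hρ2).2 g
  rcases s with xy | xy
  · exact ⟨xy, Or.inl (by simpa using h.symm)⟩
  · exact ⟨xy, Or.inr (by simpa using h.symm)⟩

/-- **Change of frame**: with `(τ, κ)`, also `(τʲκ, τ)` is a frame — `τʲκ` has order `p` and `τ ∉ ⟨τʲκ⟩`.  The
`p + 1` subgroups of order `p` of `(ℤ/p)²` ("the four subgroups isomorphic to `ℤ₃` in `ℤ₃²`") are `⟨τ⟩` and the
`⟨τʲκ⟩`, `j ∈ ℤ/p`. [cite: Dodson1987, Prop. 4.4 (2) (proof)] -/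
theorem frame_change (hτ : orderOf τ = p) (hκ : orderOf κ = p) (hτκ : κ ∉ Subgroup.zpowers τ) (j : ℕ) :
    orderOf (τ ^ j * κ) = p ∧ τ ∉ Subgroup.zpowers (τ ^ j * κ) := by
  have hτp : τ ^ p = 1 := by rw [← hτ]; exact pow_orderOf_eq_one τ
  have hκp : κ ^ p = 1 := by rw [← hκ]; exact pow_orderOf_eq_one κ
  have hne : τ ^ j * κ ≠ 1 := by
    intro h1
    apply hτκ
    rw [eq_inv_of_mul_eq_one_right h1]
    exact inv_mem (pow_mem (Subgroup.mem_zpowers τ) j)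
  have hord : orderOf (τ ^ j * κ) = p := by
    refine orderOf_eq_prime ?_ hne
    rw [mul_pow, ← pow_mul, pow_mul', hτp, one_pow, hκp, one_mul]
  refine ⟨hord, fun hmem => ?_⟩
  haveI : Fact (orderOf (τ ^ j * κ)).Prime := ⟨hord.symm ▸ hp.out⟩
  -- if `τ ∈ ⟨τʲκ⟩` then `⟨τ⟩ = ⟨τʲκ⟩ ∋ τʲκ`, so `κ ∈ ⟨τ⟩`
  have hτ1 : τ ≠ 1 := fun h1 => by
    rw [h1, orderOf_one] at hτ; exact hp.out.one_lt.ne' hτ.symm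
  have heq : Subgroup.zpowers τ = Subgroup.zpowers (τ ^ j * κ) := by
    have hle : Subgroup.zpowers τ ≤ Subgroup.zpowers (τ ^ j * κ) :=
      (Subgroup.zpowers_le (G := G)).2 hmem
    refine (Subgroup.eq_of_le_of_card_ge hle ?_)
    rw [Nat.card_zpowers, Nat.card_zpowers, hτ, hord]
  apply hτκ
  have hmem' : τ ^ j * κ ∈ Subgroup.zpowers τ := by rw [heq]; exact Subgroup.mem_zpowers _
  have := mul_mem (inv_mem (pow_mem (Subgroup.mem_zpowers τ) j)) hmem'
  rwa [inv_mul_cancel_left] at this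

/-- The swapped frame `(κ, τ)`: `τ ∉ ⟨κ⟩`. [cite: Dodson1987, Example 4.3] -/
theorem frame_swap (hτ : orderOf τ = p) (hκ : orderOf κ = p) (hτκ : κ ∉ Subgroup.zpowers τ) :
    τ ∉ Subgroup.zpowers κ := by
  have := (frame_change hτ hκ hτκ 0).2
  rwa [pow_zero, one_mul] at this

omit [Fintype G] in
/-- `τ^{(x + x').val} = τ^{x.val} τ^{x'.val}` for `τ` of order `p`. [folklore] -/
private theorem pow_val_add (hτ : orderOf τ = p) (x x' : ZMod p) :
    τ ^ (x + x').val = τ ^ x.val * τ ^ x'.val := by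
  haveI : NeZero p := ⟨hp.out.ne_zero⟩
  have h := pow_mod_orderOf τ (x.val + x'.val)
  rw [hτ] at h
  rw [ZMod.val_add, h, pow_add]

omit [Fintype G] in
/-- `τ^{(1 : ℤ/p).val} = τ`. [folklore] -/
private theorem pow_val_one : τ ^ (1 : ZMod p).val = τ := by
  haveI : Fact (1 < p) := ⟨hp.out.one_lt⟩
  rw [ZMod.val_one, pow_one]

omit [Fintype G] in
/-- `τ^{(n : ℤ/p).val} = τⁿ` for `τ` of order `p`. [folklore] -/
private theorem pow_val_natCast (hτ : orderOf τ = p) (n : ℕ) : τ ^ (n : ZMod p).val = τ ^ n := by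
  haveI : NeZero p := ⟨hp.out.ne_zero⟩
  rw [ZMod.val_natCast, ← hτ, pow_mod_orderOf]

omit [Fintype G] hp in
/-- `τᵃκᵇ · τᶜκᵈ = τ^{a+c} κ^{b+d}`. [folklore] -/
private theorem coord_mul_coord (a b c d : ℕ) :
    τ ^ a * κ ^ b * (τ ^ c * κ ^ d) = τ ^ (a + c) * κ ^ (b + d) := by
  rw [pow_add, pow_add]; ac_rfl

omit [Fintype G] in
/-- Normal forms: `τᵃκᵇ = τᵃ'κᵇ'` as soon as `a ≡ a'`, `b ≡ b' (mod p)`. [folklore] -/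
private theorem coord_congr (hτ : orderOf τ = p) (hκ : orderOf κ = p) {a a' b b' : ℕ}
    (ha : (a : ZMod p) = a') (hb : (b : ZMod p) = b') : τ ^ a * κ ^ b = τ ^ a' * κ ^ b' := by
  rw [← pow_val_natCast hτ a, ← pow_val_natCast hτ a', ← pow_val_natCast hκ b, ← pow_val_natCast hκ b',
    ha, hb]

omit [Fintype G] in
/-- **The cosets of `⟨τʲκ⟩` in coordinates**: `(τʲκ)ʸ τᵗ = τ^{jy+t} κʸ`. [cite: Dodson1987, Prop. 4.4 (2) (proof)] -/
theorem diag_coord (hτ : orderOf τ = p) (hκ : orderOf κ = p) (j y t : ZMod p) :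
    (τ ^ j.val * κ) ^ y.val * τ ^ t.val = τ ^ (j * y + t).val * κ ^ y.val := by
  haveI : NeZero p := ⟨hp.out.ne_zero⟩
  rw [mul_pow, ← pow_mul, mul_right_comm, ← pow_add]
  refine coord_congr hτ hκ ?_ rfl
  simp only [Nat.cast_add, Nat.cast_mul, ZMod.natCast_zmod_val]

omit [Fintype G] in
/-- `τ · τᵃκᵇ = τ^{a+1} κᵇ`. [folklore] -/
private theorem tau_mul_coord (hτ : orderOf τ = p) (a b : ZMod p) :
    τ * (τ ^ a.val * κ ^ b.val) = τ ^ (a + 1).val * κ ^ b.val := by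
  rw [pow_val_add hτ, pow_val_one]; ac_rfl

omit [Fintype G] in
/-- `τʲκ · τᵃκᵇ = τ^{a+j} κ^{b+1}`. [folklore] -/
private theorem diag_mul_coord (hτ : orderOf τ = p) (hκ : orderOf κ = p) (j a b : ZMod p) :
    τ ^ j.val * κ * (τ ^ a.val * κ ^ b.val) = τ ^ (a + j).val * κ ^ (b + 1).val := by
  rw [pow_val_add hτ, pow_val_add hκ, pow_val_one]; ac_rfl

end Frame

/-! ## §2 The character sum of a type in coordinates -/

section CharacterSum

variable {G : Type*} [CommGroup G] [Fintype G] [DecidableEq G] {p : ℕ} [hp : Fact p.Prime] {ρ τ κ : G}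
  {Φ : Finset G}

omit [Fintype G] [DecidableEq G] in
/-- `χ(gh) = χ(g)χ(h)`. [folklore] -/
private theorem char_mul (χ : AddChar (Additive G) ℂ) (g h : G) :
    χ (Additive.ofMul (g * h)) = χ (Additive.ofMul g) * χ (Additive.ofMul h) := by
  rw [ofMul_mul, AddChar.map_add_eq_mul]

omit [Fintype G] [DecidableEq G] in
/-- `χ(gᵉ) = χ(g)ᵉ`. [folklore] -/
private theorem char_pow (χ : AddChar (Additive G) ℂ) (g : G) (e : ℕ) :
    χ (Additive.ofMul (g ^ e)) = χ (Additive.ofMul g) ^ e := by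
  rw [ofMul_pow, AddChar.map_nsmul_eq_pow]

omit [Fintype G] [DecidableEq G] hp in
/-- `χ(τ)^p = 1` for `τ` of order `p`. [folklore] -/
private theorem char_pow_orderOf_eq_one (hτ : orderOf τ = p) (χ : AddChar (Additive G) ℂ) :
    χ (Additive.ofMul τ) ^ p = 1 := by
  rw [← char_pow, ← hτ, pow_orderOf_eq_one, ofMul_one, AddChar.map_zero_eq_one]

omit [Fintype G] [DecidableEq G] in
/-- `ρ² = 1` for the conjugation of a CM type. [folklore] -/
private theorem rho_mul_rho (h : IsCMTypeWith ρ (Φ : Set G)) : ρ * ρ = 1 := by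
  have := h.invol (1 : G)
  simpa [smul_eq_mul] using this

omit [Fintype G] [DecidableEq G] in
/-- `ρ ≠ 1` for the conjugation of a CM type. [folklore] -/
private theorem rho_ne_one (h : IsCMTypeWith ρ (Φ : Set G)) : ρ ≠ 1 := by
  intro hρ
  have := h.rho_smul_ne (1 : G)
  rw [hρ, smul_eq_mul, one_mul] at this
  exact this rfl

/-- **The character sum of a type in the frame `(τ, κ)`** (Kubota's / Hazama's character formula on
`⟨ρ⟩ × ℤₚ²`): for an ODD character `χ` and a CM type `S`, `Σ_{s∈S} χ(s) = Σ_{x,y} E(S)(x,y) χ(τ)ˣ χ(κ)ʸ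
= V(E(S); χ(τ), χ(κ))` with `E(S)(x,y) = ±1` according as `τˣκʸ ∈ S` (the tree's `signMatrix p p S τ κ` and
`pairSum`). [cite: Hazama2003CyclicCM, Prop. 4.1 and (4.1)] [cite: Kubota1965, §4 Lemma 2] -/
theorem sum_char_eq_pairSum (hp2 : p ≠ 2) (hτ : orderOf τ = p) (hκ : orderOf κ = p)
    (hτκ : κ ∉ Subgroup.zpowers τ) (hcard : Fintype.card G = 2 * p ^ 2) (h : IsCMTypeWith ρ (Φ : Set G))
    (χ : AddChar (Additive G) ℂ) (hχ : χ (Additive.ofMul ρ) = -1) :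
    haveI : NeZero p := ⟨hp.out.ne_zero⟩
    ∑ s ∈ Φ, χ (Additive.ofMul s) =
      pairSum (signMatrix p p Φ τ κ) (χ (Additive.ofMul τ)) (χ (Additive.ofMul κ)) := by
  haveI : NeZero p := ⟨hp.out.ne_zero⟩
  set e : (ZMod p × ZMod p) ⊕ (ZMod p × ZMod p) → G := fun s =>
    Sum.elim (fun xy => τ ^ xy.1.val * κ ^ xy.2.val) (fun xy => ρ * (τ ^ xy.1.val * κ ^ xy.2.val)) s with he
  have hbij : Function.Bijective e := coord_bijective hp2 hτ hκ hτκ hcard (rho_ne_one h) (rho_mul_rho h)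
  have h1 : ∑ s ∈ Φ, χ (Additive.ofMul s) = ∑ g : G, if g ∈ Φ then χ (Additive.ofMul g) else 0 := by
    rw [← Finset.sum_filter, Finset.filter_mem_eq_inter, Finset.univ_inter]
  have h2 : (∑ g : G, if g ∈ Φ then χ (Additive.ofMul g) else 0) =
      ∑ s : (ZMod p × ZMod p) ⊕ (ZMod p × ZMod p), if e s ∈ Φ then χ (Additive.ofMul (e s)) else 0 :=
    (Fintype.sum_bijective e hbij (fun s => if e s ∈ Φ then χ (Additive.ofMul (e s)) else 0)
      (fun g => if g ∈ Φ then χ (Additive.ofMul g) else 0) fun _ => rfl).symm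
  rw [h1, h2, Fintype.sum_sum_type]
  unfold pairSum
  rw [← Finset.sum_add_distrib]
  refine Finset.sum_congr rfl fun xy _ => ?_
  have hval : χ (Additive.ofMul (τ ^ xy.1.val * κ ^ xy.2.val)) =
      χ (Additive.ofMul τ) ^ xy.1.val * χ (Additive.ofMul κ) ^ xy.2.val := by
    rw [char_mul, char_pow, char_pow]
  simp only [he, Sum.elim_inl, Sum.elim_inr]
  unfold signMatrix typeSign
  by_cases hm : τ ^ xy.1.val * κ ^ xy.2.val ∈ Φ
  · have hm' : ρ * (τ ^ xy.1.val * κ ^ xy.2.val) ∉ Φ := fun h' => (rho_mul_mem_iff h _).1 h' hm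
    rw [if_neg hm', if_pos hm, if_pos hm, hval, add_zero, Int.cast_one, one_mul]
  · have hm' : ρ * (τ ^ xy.1.val * κ ^ xy.2.val) ∈ Φ := (rho_mul_mem_iff h _).2 hm
    rw [if_pos hm', if_neg hm, if_neg hm, char_mul, hχ, hval, zero_add]
    push_cast
    ring

/-- **The odd character trivial on `(ℤ/p)²` never vanishes on a type** (`χ(τ) = χ(κ) = 1`: `χ(S)` is a sum of `p²`
signs, an odd integer). [cite: Hazama2003CyclicCM, Prop. 4.2] [cite: Kubota1965, §4 Lemma 2] -/
theorem sum_char_ne_zero_of_apply_eq_one (hp2 : p ≠ 2) (hτ : orderOf τ = p) (hκ : orderOf κ = p)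
    (hτκ : κ ∉ Subgroup.zpowers τ) (hcard : Fintype.card G = 2 * p ^ 2) (h : IsCMTypeWith ρ (Φ : Set G))
    (χ : AddChar (Additive G) ℂ) (hχ : χ (Additive.ofMul ρ) = -1) (hχτ : χ (Additive.ofMul τ) = 1)
    (hχκ : χ (Additive.ofMul κ) = 1) : ∑ s ∈ Φ, χ (Additive.ofMul s) ≠ 0 := by
  haveI : NeZero p := ⟨hp.out.ne_zero⟩
  rw [sum_char_eq_pairSum hp2 hτ hκ hτκ hcard h χ hχ, hχτ, hχκ]
  unfold pairSum
  simp only [one_pow, mul_one]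
  have hint : ∑ xy : ZMod p × ZMod p, (signMatrix p p Φ τ κ xy : ℂ) =
      ((∑ xy : ZMod p × ZMod p, signMatrix p p Φ τ κ xy : ℤ) : ℂ) := by push_cast; rfl
  rw [hint, Int.cast_ne_zero]
  have hrows : ∑ xy : ZMod p × ZMod p, signMatrix p p Φ τ κ xy =
      2 * (∑ y : ZMod p, (rowCount p p Φ τ κ y : ℤ)) - p * p := by
    rw [Fintype.sum_prod_type_right]
    simp_rw [sum_signMatrix_row]
    rw [Finset.sum_sub_distrib, Finset.sum_const, Finset.card_univ, ZMod.card, ← Finset.mul_sum]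
    simp
  rw [hrows]
  obtain ⟨k, hk⟩ := (hp.out.odd_of_ne_two hp2).mul (hp.out.odd_of_ne_two hp2)
  have hk' : ((p * p : ℕ) : ℤ) = 2 * k + 1 := by exact_mod_cast hk
  push_cast at hk'
  omega

/-- An element `ω ≠ 1` with `ω^p = 1` is a primitive `p`-th root of unity. [folklore] -/
private theorem isPrimitiveRoot_of_pow_eq_one {ω : ℂ} (hωp : ω ^ p = 1) (hω1 : ω ≠ 1) :
    IsPrimitiveRoot ω p :=
  IsPrimitiveRoot.iff_orderOf.2 (orderOf_eq_prime hωp hω1)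

/-- **The odd characters trivial on `⟨τ⟩` and non-trivial on `⟨κ⟩` (kernel in `(ℤ/p)²` = the subgroup `⟨τ⟩`).**
`χ(S) = 0` iff `S` meets the `p` cosets `κʸ⟨τ⟩` in the SAME number of points — constant row counts
`#{x : τˣκʸ ∈ S}` (Hazama's "(0,1)-matrices with constant row sum"; Dodson: "the coordinates of `f`" have the
same weight on the cosets of one of "the four subgroups isomorphic to `ℤ₃` in `ℤ₃²`").
[cite: Hazama2003CyclicCM, Prop. 4.3] [cite: Dodson1987, Prop. 4.4 (2)] -/
theorem sum_char_eq_zero_iff_hasConstantRows (hp2 : p ≠ 2) (hτ : orderOf τ = p) (hκ : orderOf κ = p)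
    (hτκ : κ ∉ Subgroup.zpowers τ) (hcard : Fintype.card G = 2 * p ^ 2) (h : IsCMTypeWith ρ (Φ : Set G))
    (χ : AddChar (Additive G) ℂ) (hχ : χ (Additive.ofMul ρ) = -1) (hχτ : χ (Additive.ofMul τ) = 1)
    (hχκ : χ (Additive.ofMul κ) ≠ 1) :
    haveI : NeZero p := ⟨hp.out.ne_zero⟩
    ∑ s ∈ Φ, χ (Additive.ofMul s) = 0 ↔ HasConstantRows p p Φ τ κ := by
  haveI : NeZero p := ⟨hp.out.ne_zero⟩
  have hν := isPrimitiveRoot_of_pow_eq_one (char_pow_orderOf_eq_one hκ χ) hχκ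
  rw [sum_char_eq_pairSum hp2 hτ hκ hτκ hcard h χ hχ, hχτ, pairSum_one_left_eq_zero_iff hν]
  exact forall_sum_signMatrix_row_eq_iff p p Φ τ κ

/-- **The odd characters non-trivial on `⟨τ⟩`: the kernel in `(ℤ/p)²` is a "diagonal" subgroup `⟨τʲκ⟩`.**  If
`χ(τ) ≠ 1` and `χ(τ)ʲχ(κ) = 1`, then `χ(S) = 0` iff `S` meets the `p` cosets `τᵗ⟨τʲκ⟩` in the same number of
points (constant row counts in the frame `(τʲκ, τ)`). [cite: Dodson1987, Prop. 4.4 (2)] [cite: Hazama2003CyclicCM, Prop. 4.3] -/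
theorem sum_char_eq_zero_iff_hasConstantRows_diag (hp2 : p ≠ 2) (hτ : orderOf τ = p) (hκ : orderOf κ = p)
    (hτκ : κ ∉ Subgroup.zpowers τ) (hcard : Fintype.card G = 2 * p ^ 2) (h : IsCMTypeWith ρ (Φ : Set G))
    (χ : AddChar (Additive G) ℂ) (hχ : χ (Additive.ofMul ρ) = -1) (hχτ : χ (Additive.ofMul τ) ≠ 1)
    (j : ℕ) (hj : χ (Additive.ofMul τ) ^ j * χ (Additive.ofMul κ) = 1) :
    haveI : NeZero p := ⟨hp.out.ne_zero⟩
    ∑ s ∈ Φ, χ (Additive.ofMul s) = 0 ↔ HasConstantRows p p Φ (τ ^ j * κ) τ := by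
  obtain ⟨hord, hnot⟩ := frame_change hτ hκ hτκ j
  have hχ' : χ (Additive.ofMul (τ ^ j * κ)) = 1 := by rw [char_mul, char_pow, hj]
  exact sum_char_eq_zero_iff_hasConstantRows hp2 hord hτ hnot hcard h χ hχ hχ' hχτ

omit [Fintype G] [DecidableEq G] in
/-- For an odd `χ` with `χ(τ) ≠ 1` there is a unique `j ∈ ℤ/p` with `χ(τ)ʲ χ(κ) = 1` (`χ(τ)` is a primitive
`p`-th root of unity and `χ(κ)^p = 1`). [cite: Dodson1987, Prop. 4.4 (2) (proof)] -/
theorem existsUnique_diag (hτ : orderOf τ = p) (hκ : orderOf κ = p) (χ : AddChar (Additive G) ℂ)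
    (hχτ : χ (Additive.ofMul τ) ≠ 1) :
    ∃! j : ZMod p, χ (Additive.ofMul τ) ^ j.val * χ (Additive.ofMul κ) = 1 := by
  haveI : NeZero p := ⟨hp.out.ne_zero⟩
  have hμ := isPrimitiveRoot_of_pow_eq_one (char_pow_orderOf_eq_one hτ χ) hχτ
  -- `χ(κ)⁻¹ = χ(τ)^i` for some `i < p`
  have hκinv : (χ (Additive.ofMul κ))⁻¹ ^ p = 1 := by rw [inv_pow, char_pow_orderOf_eq_one hκ χ, inv_one]
  obtain ⟨i, hi, hiκ⟩ := hμ.eq_pow_of_pow_eq_one hκinv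
  have hκ0 : χ (Additive.ofMul κ) ≠ 0 := fun h0 => by
    have := char_pow_orderOf_eq_one hκ χ
    rw [h0, zero_pow hp.out.ne_zero] at this
    exact zero_ne_one this
  refine ⟨(i : ZMod p), ?_, fun j hj => ?_⟩
  · simp only
    rw [ZMod.val_natCast, Nat.mod_eq_of_lt hi, hiκ, inv_mul_cancel₀ hκ0]
  · have hj' : χ (Additive.ofMul τ) ^ j.val = χ (Additive.ofMul τ) ^ i := by
      rw [hiκ]; exact eq_inv_of_mul_eq_one_left hj
    have := hμ.pow_inj (ZMod.val_lt j) hi hj'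
    rw [← ZMod.natCast_zmod_val j, this]

end CharacterSum

/-! ## §3 Counting the vanishing odd characters: `p − 1` for each direction of equidistribution -/

section Defect

variable {G : Type*} [CommGroup G] [Fintype G] [DecidableEq G] {p : ℕ} [hp : Fact p.Prime] {ρ τ κ : G}
  {Φ : Finset G}

open Dodson1984 (ncard_oddChar)

omit [DecidableEq G] in
/-- **An odd character of `⟨ρ⟩ × ⟨τ⟩ × ⟨κ⟩` is determined by its values at `τ` and `κ`.** [folklore] -/
private theorem oddChar_injOn (hp2 : p ≠ 2) (hτ : orderOf τ = p) (hκ : orderOf κ = p)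
    (hτκ : κ ∉ Subgroup.zpowers τ) (hcard : Fintype.card G = 2 * p ^ 2) (hρ1 : ρ ≠ 1) (hρ2 : ρ * ρ = 1) :
    Set.InjOn (fun χ : AddChar (Additive G) ℂ => (χ (Additive.ofMul τ), χ (Additive.ofMul κ)))
      {χ : AddChar (Additive G) ℂ | χ (Additive.ofMul ρ) = -1} := by
  intro χ₁ h₁ χ₂ h₂ heq
  simp only [Set.mem_setOf_eq, Prod.mk.injEq] at h₁ h₂ heq
  refine DFunLike.ext _ _ fun a => ?_
  obtain ⟨⟨x, y⟩, hx | hx⟩ := exists_coord hp2 hτ hκ hτκ hcard hρ1 hρ2 (Additive.toMul a)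
  · have : a = Additive.ofMul (τ ^ x.val * κ ^ y.val) := by rw [← hx]; rfl
    rw [this, char_mul, char_mul, char_pow, char_pow, char_pow, char_pow, heq.1, heq.2]
  · have : a = Additive.ofMul (ρ * (τ ^ x.val * κ ^ y.val)) := by rw [← hx]; rfl
    rw [this, char_mul, char_mul, char_mul, char_mul, char_pow, char_pow, char_pow, char_pow, h₁, h₂,
      heq.1, heq.2]

/-- The pairs of `p`-th roots of unity in `ℂ` as a set are a finset. [folklore] -/
private theorem setOf_pow_eq_one_prod_eq :
    {μν : ℂ × ℂ | μν.1 ^ p = 1 ∧ μν.2 ^ p = 1} =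
      ↑(Polynomial.nthRootsFinset p (1 : ℂ) ×ˢ Polynomial.nthRootsFinset p (1 : ℂ)) := by
  ext μν
  rw [Set.mem_setOf_eq, Finset.coe_product, Set.mem_prod, Finset.mem_coe, Finset.mem_coe,
    Polynomial.mem_nthRootsFinset hp.out.pos, Polynomial.mem_nthRootsFinset hp.out.pos]

/-- `#{(μ, ν) : μ^p = ν^p = 1} = p²`. [folklore] -/
private theorem ncard_setOf_pow_eq_one_prod :
    {μν : ℂ × ℂ | μν.1 ^ p = 1 ∧ μν.2 ^ p = 1}.ncard = p ^ 2 := by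
  rw [setOf_pow_eq_one_prod_eq, Set.ncard_coe_finset, Finset.card_product,
    (Complex.isPrimitiveRoot_exp p hp.out.ne_zero).card_nthRootsFinset, sq]

omit [DecidableEq G] in
/-- **`χ ↦ (χ(τ), χ(κ))` maps the odd characters ONTO the pairs of `p`-th roots of unity** (injective, and both
sets have `p²` elements). [folklore] -/
private theorem image_oddChar_eq (hp2 : p ≠ 2) (hτ : orderOf τ = p) (hκ : orderOf κ = p)
    (hτκ : κ ∉ Subgroup.zpowers τ) (hcard : Fintype.card G = 2 * p ^ 2) (hρ1 : ρ ≠ 1) (hρ2 : ρ * ρ = 1) :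
    (fun χ : AddChar (Additive G) ℂ => (χ (Additive.ofMul τ), χ (Additive.ofMul κ))) ''
        {χ : AddChar (Additive G) ℂ | χ (Additive.ofMul ρ) = -1} =
      {μν : ℂ × ℂ | μν.1 ^ p = 1 ∧ μν.2 ^ p = 1} := by
  apply Set.eq_of_subset_of_ncard_le
  · rintro _ ⟨χ, -, rfl⟩
    exact ⟨char_pow_orderOf_eq_one hτ χ, char_pow_orderOf_eq_one hκ χ⟩
  · rw [(oddChar_injOn hp2 hτ hκ hτκ hcard hρ1 hρ2).ncard_image, ncard_oddChar hρ1 hρ2 hcard,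
      ncard_setOf_pow_eq_one_prod]
  · rw [setOf_pow_eq_one_prod_eq]
    exact Finset.finite_toSet _

/-- `#{ν : ν^p = 1, ν ≠ 1} = p − 1`. [folklore] -/
private theorem ncard_setOf_pow_eq_one_ne_one : {ν : ℂ | ν ^ p = 1 ∧ ν ≠ 1}.ncard = p - 1 := by
  have h1 : {ν : ℂ | ν ^ p = 1} = ↑(Polynomial.nthRootsFinset p (1 : ℂ)) := by
    ext ν; rw [Set.mem_setOf_eq, Finset.mem_coe, Polynomial.mem_nthRootsFinset hp.out.pos]
  have hset : {ν : ℂ | ν ^ p = 1 ∧ ν ≠ 1} = {ν : ℂ | ν ^ p = 1} \ {1} := by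
    ext ν; simp only [Set.mem_setOf_eq, Set.mem_sdiff, Set.mem_singleton_iff]
  rw [hset, Set.ncard_sdiff_singleton_of_mem (by simp : (1 : ℂ) ∈ {ν : ℂ | ν ^ p = 1}), h1,
    Set.ncard_coe_finset, (Complex.isPrimitiveRoot_exp p hp.out.ne_zero).card_nthRootsFinset]

omit [DecidableEq G] in
/-- **Each of the `p + 1` subgroups of order `p` is the kernel-in-`(ℤ/p)²` of exactly `p − 1` odd characters**:
`#{χ odd : χ(τ) = 1, χ(κ) ≠ 1} = p − 1` for every frame `(τ, κ)`. [cite: Dodson1987, Prop. 4.4 (2) (proof: "the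
four subgroups isomorphic to `ℤ₃` in `ℤ₃²`")] [cite: Kubota1965, §4 Lemma 2] -/
theorem ncard_oddChar_class (hp2 : p ≠ 2) (hτ : orderOf τ = p) (hκ : orderOf κ = p)
    (hτκ : κ ∉ Subgroup.zpowers τ) (hcard : Fintype.card G = 2 * p ^ 2) (hρ1 : ρ ≠ 1) (hρ2 : ρ * ρ = 1) :
    {χ : AddChar (Additive G) ℂ | χ (Additive.ofMul ρ) = -1 ∧ χ (Additive.ofMul τ) = 1 ∧
        χ (Additive.ofMul κ) ≠ 1}.ncard = p - 1 := by
  set ev : AddChar (Additive G) ℂ → ℂ × ℂ := fun χ => (χ (Additive.ofMul τ), χ (Additive.ofMul κ)) with hev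
  have hsub : {χ : AddChar (Additive G) ℂ | χ (Additive.ofMul ρ) = -1 ∧ χ (Additive.ofMul τ) = 1 ∧
      χ (Additive.ofMul κ) ≠ 1} ⊆ {χ : AddChar (Additive G) ℂ | χ (Additive.ofMul ρ) = -1} :=
    fun χ hχ => hχ.1
  have himg : ev '' {χ : AddChar (Additive G) ℂ | χ (Additive.ofMul ρ) = -1 ∧ χ (Additive.ofMul τ) = 1 ∧
      χ (Additive.ofMul κ) ≠ 1} = (fun ν : ℂ => ((1 : ℂ), ν)) '' {ν : ℂ | ν ^ p = 1 ∧ ν ≠ 1} := by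
    ext μν
    simp only [Set.mem_image, Set.mem_setOf_eq, hev]
    constructor
    · rintro ⟨χ, ⟨-, h1, h2⟩, rfl⟩
      exact ⟨χ (Additive.ofMul κ), ⟨char_pow_orderOf_eq_one hκ χ, h2⟩, by rw [h1]⟩
    · rintro ⟨ν, ⟨hν, hν1⟩, rfl⟩
      have hmem : ((1 : ℂ), ν) ∈ ev '' {χ : AddChar (Additive G) ℂ | χ (Additive.ofMul ρ) = -1} := by
        rw [hev, image_oddChar_eq hp2 hτ hκ hτκ hcard hρ1 hρ2]
        exact ⟨by simp, hν⟩
      obtain ⟨χ, hχ, hχe⟩ := hmem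
      simp only [hev, Prod.mk.injEq] at hχe
      exact ⟨χ, ⟨hχ, hχe.1, by rw [hχe.2]; exact hν1⟩, by rw [hχe.1, hχe.2]⟩
  rw [← ((oddChar_injOn hp2 hτ hκ hτκ hcard hρ1 hρ2).mono hsub).ncard_image, himg,
    Set.ncard_image_of_injective _ fun ν ν' h => (Prod.mk.injEq _ _ _ _ ▸ h).2,
    ncard_setOf_pow_eq_one_ne_one]

/-- **The vanishing criterion for an arbitrary odd character** (all kinds together): `χ(S) = 0` iff EITHER
`χ(τ) = 1 ≠ χ(κ)` and `S` is equidistributed over the cosets of `⟨τ⟩`, OR `χ(τ) ≠ 1 = χ(τʲκ)` for (the unique)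
`j ∈ ℤ/p` and `S` is equidistributed over the cosets of `⟨τʲκ⟩`. [cite: Kubota1965, §4 Lemma 2] [cite: Dodson1987, Prop. 4.4 (2)] -/
theorem sum_char_eq_zero_iff (hp2 : p ≠ 2) (hτ : orderOf τ = p) (hκ : orderOf κ = p)
    (hτκ : κ ∉ Subgroup.zpowers τ) (hcard : Fintype.card G = 2 * p ^ 2) (h : IsCMTypeWith ρ (Φ : Set G))
    (χ : AddChar (Additive G) ℂ) (hχ : χ (Additive.ofMul ρ) = -1) :
    haveI : NeZero p := ⟨hp.out.ne_zero⟩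
    ∑ s ∈ Φ, χ (Additive.ofMul s) = 0 ↔
      (χ (Additive.ofMul τ) = 1 ∧ χ (Additive.ofMul κ) ≠ 1 ∧ HasConstantRows p p Φ τ κ) ∨
        ∃ j : ZMod p, χ (Additive.ofMul τ) ≠ 1 ∧ χ (Additive.ofMul (τ ^ j.val * κ)) = 1 ∧
          HasConstantRows p p Φ (τ ^ j.val * κ) τ := by
  haveI : NeZero p := ⟨hp.out.ne_zero⟩
  by_cases hχτ : χ (Additive.ofMul τ) = 1
  · by_cases hχκ : χ (Additive.ofMul κ) = 1
    · have hne := sum_char_ne_zero_of_apply_eq_one hp2 hτ hκ hτκ hcard h χ hχ hχτ hχκ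
      simp only [hne, hχκ, ne_eq, not_true_eq_false, false_and, and_false, hχτ, false_and,
        exists_false, or_false]
    · rw [sum_char_eq_zero_iff_hasConstantRows hp2 hτ hκ hτκ hcard h χ hχ hχτ hχκ]
      simp only [hχτ, hχκ, ne_eq, not_false_eq_true, true_and, not_true_eq_false, false_and, exists_false,
        or_false]
  · obtain ⟨j, hj, hjuniq⟩ := existsUnique_diag hτ hκ χ hχτ
    have hval : ∀ j' : ZMod p, χ (Additive.ofMul (τ ^ j'.val * κ)) =
        χ (Additive.ofMul τ) ^ j'.val * χ (Additive.ofMul κ) := fun j' => by rw [char_mul, char_pow]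
    rw [sum_char_eq_zero_iff_hasConstantRows_diag hp2 hτ hκ hτκ hcard h χ hχ hχτ j.val hj]
    simp only [hχτ, false_and, false_or, ne_eq, not_false_eq_true, true_and]
    constructor
    · intro hr
      exact ⟨j, by rw [hval, hj], hr⟩
    · rintro ⟨j', hj', hr'⟩
      rw [hval] at hj'
      rwa [← hjuniq j' hj']

open scoped Classical in
/-- **The number of odd characters vanishing on `S`** (Kubota's defect): `p − 1` for each of the `p + 1`
subgroups `H` of order `p` of `(ℤ/p)²` over whose cosets `S` is equidistributed — `H = ⟨τ⟩` (constant row counts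
in the frame `(τ, κ)`) and `H = ⟨τʲκ⟩`, `j ∈ ℤ/p` (constant row counts in the frame `(τʲκ, τ)`).
[cite: Kubota1965, §4 Lemma 2] [cite: Dodson1987, Prop. 4.4 (2)] -/
theorem ncard_oddChar_vanishing_eq (hp2 : p ≠ 2) (hτ : orderOf τ = p) (hκ : orderOf κ = p)
    (hτκ : κ ∉ Subgroup.zpowers τ) (hcard : Fintype.card G = 2 * p ^ 2) (h : IsCMTypeWith ρ (Φ : Set G)) :
    haveI : NeZero p := ⟨hp.out.ne_zero⟩
    {χ : AddChar (Additive G) ℂ | χ (Additive.ofMul ρ) = -1 ∧ ∑ s ∈ Φ, χ (Additive.ofMul s) = 0}.ncard =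
      (if HasConstantRows p p Φ τ κ then p - 1 else 0) +
        (Finset.univ.filter fun j : ZMod p => HasConstantRows p p Φ (τ ^ j.val * κ) τ).card * (p - 1) := by
  haveI : NeZero p := ⟨hp.out.ne_zero⟩
  have hρ1 := rho_ne_one h
  have hρ2 := rho_mul_rho h
  set O : Set (AddChar (Additive G) ℂ) := {χ | χ (Additive.ofMul ρ) = -1} with hO
  set Vinf : Set (AddChar (Additive G) ℂ) := {χ | χ (Additive.ofMul ρ) = -1 ∧ χ (Additive.ofMul τ) = 1 ∧
    χ (Additive.ofMul κ) ≠ 1 ∧ HasConstantRows p p Φ τ κ} with hVinf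
  set V : ZMod p → Set (AddChar (Additive G) ℂ) := fun j => {χ | χ (Additive.ofMul ρ) = -1 ∧
    χ (Additive.ofMul (τ ^ j.val * κ)) = 1 ∧ χ (Additive.ofMul τ) ≠ 1 ∧
      HasConstantRows p p Φ (τ ^ j.val * κ) τ} with hV
  -- the decomposition of the vanishing set
  have hdec : {χ : AddChar (Additive G) ℂ | χ (Additive.ofMul ρ) = -1 ∧ ∑ s ∈ Φ, χ (Additive.ofMul s) = 0} =
      Vinf ∪ ⋃ j, V j := by
    ext χ
    simp only [Set.mem_setOf_eq, Set.mem_union, Set.mem_iUnion, hVinf, hV]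
    constructor
    · rintro ⟨hχ, h0⟩
      rcases (sum_char_eq_zero_iff hp2 hτ hκ hτκ hcard h χ hχ).1 h0 with ⟨h1, h2, h3⟩ | ⟨j, h1, h2, h3⟩
      · exact Or.inl ⟨hχ, h1, h2, h3⟩
      · exact Or.inr ⟨j, hχ, h2, h1, h3⟩
    · rintro (⟨hχ, h1, h2, h3⟩ | ⟨j, hχ, h1, h2, h3⟩)
      · exact ⟨hχ, (sum_char_eq_zero_iff hp2 hτ hκ hτκ hcard h χ hχ).2 (Or.inl ⟨h1, h2, h3⟩)⟩
      · exact ⟨hχ, (sum_char_eq_zero_iff hp2 hτ hκ hτκ hcard h χ hχ).2 (Or.inr ⟨j, h2, h1, h3⟩)⟩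
  -- the pieces are pairwise disjoint
  have hdisj1 : Disjoint Vinf (⋃ j, V j) := by
    rw [Set.disjoint_iUnion_right]
    intro j
    rw [Set.disjoint_left]
    rintro χ ⟨-, h1, -, -⟩ ⟨-, -, h2, -⟩
    exact h2 h1
  have hdisj2 : Pairwise (Function.onFun Disjoint V) := by
    intro j j' hjj'
    rw [Function.onFun, Set.disjoint_left]
    rintro χ ⟨-, h1, h2, -⟩ ⟨-, h1', -, -⟩
    apply hjj'
    obtain ⟨j₀, -, huniq⟩ := existsUnique_diag hτ hκ χ h2
    rw [char_mul, char_pow] at h1 h1'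
    rw [huniq j h1, huniq j' h1']
  -- the counts of the pieces
  have hcinf : Vinf.ncard = if HasConstantRows p p Φ τ κ then p - 1 else 0 := by
    split_ifs with hr
    · have : Vinf = {χ : AddChar (Additive G) ℂ | χ (Additive.ofMul ρ) = -1 ∧ χ (Additive.ofMul τ) = 1 ∧
          χ (Additive.ofMul κ) ≠ 1} := by
        ext χ; simp only [hVinf, Set.mem_setOf_eq, hr, and_true]
      rw [this, ncard_oddChar_class hp2 hτ hκ hτκ hcard hρ1 hρ2]
    · have : Vinf = ∅ := by
        ext χ; simp only [hVinf, Set.mem_setOf_eq, hr, and_false, Set.mem_empty_iff_false]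
      rw [this, Set.ncard_empty]
  have hcj : ∀ j : ZMod p, (V j).ncard = if HasConstantRows p p Φ (τ ^ j.val * κ) τ then p - 1 else 0 := by
    intro j
    obtain ⟨hordj, hnotj⟩ := frame_change hτ hκ hτκ j.val
    split_ifs with hr
    · have : V j = {χ : AddChar (Additive G) ℂ | χ (Additive.ofMul ρ) = -1 ∧
          χ (Additive.ofMul (τ ^ j.val * κ)) = 1 ∧ χ (Additive.ofMul τ) ≠ 1} := by
        ext χ; simp only [hV, Set.mem_setOf_eq, hr, and_true]
      rw [this, ncard_oddChar_class hp2 hordj hτ hnotj hcard hρ1 hρ2]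
    · have : V j = ∅ := by
        ext χ; simp only [hV, Set.mem_setOf_eq, hr, and_false, Set.mem_empty_iff_false]
      rw [this, Set.ncard_empty]
  rw [hdec, Set.ncard_union_eq hdisj1 (Set.toFinite _) (Set.toFinite _), hcinf,
    Set.ncard_iUnion_of_finite (fun j => Set.toFinite _) hdisj2, finsum_eq_sum_of_fintype]
  simp_rw [hcj]
  rw [Finset.sum_ite, Finset.sum_const_zero, add_zero, Finset.sum_const, smul_eq_mul]

end Defect

/-! ## §4 The rank of every CM type of `⟨ρ⟩ × (ℤ/p)²` -/

section Rank

variable {G : Type*} [CommGroup G] [Fintype G] [DecidableEq G] {p : ℕ} [hp : Fact p.Prime] {ρ τ κ : G}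
  {Φ : Finset G}

open Dodson1984 (ncard_oddChar)

open scoped Classical in
/-- **Rank plus defect = `p² + 1`** (Kubota): `rank(S) + (p − 1)·t(S) = p² + 1`, where `t(S)` is the number of
subgroups `H` of order `p` of `(ℤ/p)²` over whose cosets `S` is equidistributed (`H = ⟨τ⟩`: constant row counts in
the frame `(τ, κ)`; `H = ⟨τʲκ⟩`: constant row counts in the frame `(τʲκ, τ)`).  Dodson's `R₀ = ℤ₃²`:
`rank(f) = 10 − 2·t(f)`. [cite: Kubota1965, §4 Lemma 2] [cite: Dodson1987, Prop. 4.4 (2)] -/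
theorem typeRank_add_defect_eq (hp2 : p ≠ 2) (hτ : orderOf τ = p) (hκ : orderOf κ = p)
    (hτκ : κ ∉ Subgroup.zpowers τ) (hcard : Fintype.card G = 2 * p ^ 2) (h : IsCMTypeWith ρ (Φ : Set G)) :
    haveI : NeZero p := ⟨hp.out.ne_zero⟩
    typeRank G (Φ : Set G) +
        ((if HasConstantRows p p Φ τ κ then p - 1 else 0) +
          (Finset.univ.filter fun j : ZMod p => HasConstantRows p p Φ (τ ^ j.val * κ) τ).card * (p - 1)) =
      p ^ 2 + 1 := by
  have hdef := h.typeRank_add_ncard_oddCharacters_vanishing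
  rw [ncard_oddChar_vanishing_eq hp2 hτ hκ hτκ hcard h, ncard_oddChar (rho_ne_one h) (rho_mul_rho h) hcard]
    at hdef
  convert hdef using 2

open scoped Classical in
/-- **Nondegeneracy criterion**: `rank(S) = p² + 1` iff `S` is equidistributed over the cosets of NONE of the
`p + 1` subgroups of order `p`. [cite: Dodson1987, Prop. 4.4 (2)] [cite: Kubota1965, §4 Lemma 2] -/
theorem typeRank_eq_iff (hp2 : p ≠ 2) (hτ : orderOf τ = p) (hκ : orderOf κ = p)
    (hτκ : κ ∉ Subgroup.zpowers τ) (hcard : Fintype.card G = 2 * p ^ 2) (h : IsCMTypeWith ρ (Φ : Set G)) :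
    haveI : NeZero p := ⟨hp.out.ne_zero⟩
    typeRank G (Φ : Set G) = p ^ 2 + 1 ↔
      ¬ HasConstantRows p p Φ τ κ ∧ ∀ j : ZMod p, ¬ HasConstantRows p p Φ (τ ^ j.val * κ) τ := by
  haveI : NeZero p := ⟨hp.out.ne_zero⟩
  have key := typeRank_add_defect_eq hp2 hτ hκ hτκ hcard h
  have hp1 : 1 < p := hp.out.one_lt
  constructor
  · intro hrk
    rw [hrk] at key
    have h0 : (if HasConstantRows p p Φ τ κ then p - 1 else 0) +
        (Finset.univ.filter fun j : ZMod p => HasConstantRows p p Φ (τ ^ j.val * κ) τ).card * (p - 1) = 0 := by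
      omega
    rw [Nat.add_eq_zero_iff] at h0
    refine ⟨fun hr => ?_, fun j hj => ?_⟩
    · rw [if_pos hr] at h0; omega
    · have hmem : j ∈ Finset.univ.filter fun j : ZMod p => HasConstantRows p p Φ (τ ^ j.val * κ) τ :=
        Finset.mem_filter.2 ⟨Finset.mem_univ _, hj⟩
      have hpos := Finset.card_pos.2 ⟨j, hmem⟩
      have := h0.2
      rw [Nat.mul_eq_zero] at this
      omega
  · rintro ⟨hr, hj⟩
    rw [if_neg hr, Finset.filter_false_of_mem fun j _ => hj j, Finset.card_empty, zero_mul, add_zero,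
      add_zero] at key
    exact key

open scoped Classical in
/-- **Degeneracy criterion**: `rank(S) ≠ p² + 1` iff `S` is equidistributed over the cosets of one of the `p + 1`
subgroups of order `p`. [cite: Dodson1987, Prop. 4.4 (2)] -/
theorem typeRank_ne_iff (hp2 : p ≠ 2) (hτ : orderOf τ = p) (hκ : orderOf κ = p)
    (hτκ : κ ∉ Subgroup.zpowers τ) (hcard : Fintype.card G = 2 * p ^ 2) (h : IsCMTypeWith ρ (Φ : Set G)) :
    haveI : NeZero p := ⟨hp.out.ne_zero⟩
    typeRank G (Φ : Set G) ≠ p ^ 2 + 1 ↔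
      HasConstantRows p p Φ τ κ ∨ ∃ j : ZMod p, HasConstantRows p p Φ (τ ^ j.val * κ) τ := by
  rw [Ne, typeRank_eq_iff hp2 hτ hκ hτκ hcard h, not_and_or, not_not, not_forall]
  simp only [not_not]

open scoped Classical in
/-- **Exactly one direction of equidistribution: `rank = p² + 1 − (p − 1) = (p − 1)p + 2`** — for `p = 3` the
rank `8` of Dodson's Prop. 4.4 (2)(a). [cite: Dodson1987, Prop. 4.4 (2)(a)] -/
theorem typeRank_eq_of_unique_direction (hp2 : p ≠ 2) (hτ : orderOf τ = p) (hκ : orderOf κ = p)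
    (hτκ : κ ∉ Subgroup.zpowers τ) (hcard : Fintype.card G = 2 * p ^ 2) (h : IsCMTypeWith ρ (Φ : Set G))
    (hone : haveI : NeZero p := ⟨hp.out.ne_zero⟩
      (if HasConstantRows p p Φ τ κ then 1 else 0) +
        (Finset.univ.filter fun j : ZMod p => HasConstantRows p p Φ (τ ^ j.val * κ) τ).card = 1) :
    typeRank G (Φ : Set G) = (p - 1) * p + 2 := by
  haveI : NeZero p := ⟨hp.out.ne_zero⟩
  have key := typeRank_add_defect_eq hp2 hτ hκ hτκ hcard h
  have hp1 : 1 < p := hp.out.one_lt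
  have hsq : (p - 1) * p + 2 + (p - 1) = p ^ 2 + 1 := by
    obtain ⟨k, rfl⟩ := Nat.exists_eq_add_of_le hp1.le
    simp only [Nat.add_sub_cancel_left, sq]
    ring
  split_ifs at key hone with hr
  · have h0 : (Finset.univ.filter fun j : ZMod p => HasConstantRows p p Φ (τ ^ j.val * κ) τ).card = 0 := by
      omega
    rw [h0, zero_mul, add_zero] at key
    omega
  · rw [zero_add] at hone
    rw [hone, one_mul, zero_add] at key
    omega

end Rank

/-! ## §5 Stabilisers: the imprimitive types (orbits of order `p`) and their ranks `p + 1`, `2` -/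

section Stabilisers

variable {G : Type*} [CommGroup G] [Fintype G] [DecidableEq G] {p : ℕ} [hp : Fact p.Prime] {ρ τ κ : G}
  {Φ : Finset G}

/-- A function on `ℤ/p` with a non-zero period is constant. [folklore] -/
private theorem const_of_periodic {f : ZMod p → ℕ} {d : ZMod p} (hd : d ≠ 0) (hf : ∀ t, f (t + d) = f t)
    (t t' : ZMod p) : f t = f t' := by
  have hn : ∀ n : ℕ, f ((n : ZMod p) * d) = f 0 := by
    intro n
    induction n with
    | zero => rw [Nat.cast_zero, zero_mul]
    | succ n ih => rw [Nat.cast_succ, add_mul, one_mul, hf, ih]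
  have key : ∀ s : ZMod p, f s = f 0 := fun s => by
    have : s = ((s * d⁻¹).val : ZMod p) * d := by rw [ZMod.natCast_zmod_val, inv_mul_cancel_right₀ hd]
    rw [this, hn]
  rw [key t, key t']

/-- Re-indexing a count along a translation of `ℤ/p`. [folklore] -/
private theorem card_filter_add_eq (P : ZMod p → Prop) [DecidablePred P] (d : ZMod p) :
    (Finset.univ.filter fun x => P (x + d)).card = (Finset.univ.filter P).card := by
  refine Finset.card_bij (fun x _ => x + d) (fun x hx => ?_) (fun x _ x' _ hxx' => add_right_cancel hxx')
    (fun x' hx' => ⟨x' - d, ?_, sub_add_cancel x' d⟩)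
  · simpa using hx
  · simpa using hx'

omit [DecidableEq G] in
/-- **Stability is read on the `(ℤ/p)²`-sheet**: `uS = S` iff `τᵃκᵇ ∈ S ↔ u·τᵃκᵇ ∈ S` for all `a, b` (the other
sheet `ρ(ℤ/p)²` follows from `S ⊔ ρS = G`). [cite: Hazama2003CyclicCM, Lemma 4.6.1 ((4.7))] -/
theorem isStableUnder_iff_coord (hp2 : p ≠ 2) (hτ : orderOf τ = p) (hκ : orderOf κ = p)
    (hτκ : κ ∉ Subgroup.zpowers τ) (hcard : Fintype.card G = 2 * p ^ 2) (h : IsCMTypeWith ρ (Φ : Set G))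
    (u : G) :
    IsStableUnder Φ u ↔ ∀ a b : ZMod p, τ ^ a.val * κ ^ b.val ∈ Φ ↔ u * (τ ^ a.val * κ ^ b.val) ∈ Φ := by
  refine ⟨fun H a b => H _, fun H s => ?_⟩
  obtain ⟨⟨a, b⟩, rfl | rfl⟩ := exists_coord hp2 hτ hκ hτκ hcard (rho_ne_one h) (rho_mul_rho h) s
  · exact H a b
  · rw [mul_left_comm u ρ, rho_mul_mem_iff h, rho_mul_mem_iff h, not_iff_not]
    exact H a b

omit [Fintype G] in
/-- **The row counts in the frame `(τʲκ, τ)` in coordinates**: `#{y : (τʲκ)ʸτᵗ ∈ S} = #{y : τ^{jy+t}κʸ ∈ S}` — the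
count of `S` on the coset `τᵗ⟨τʲκ⟩`, a "line of slope `j`". [cite: Dodson1987, Prop. 4.4 (2) (proof)] -/
theorem rowCount_diag (hτ : orderOf τ = p) (hκ : orderOf κ = p) (j t : ZMod p) :
    haveI : NeZero p := ⟨hp.out.ne_zero⟩
    rowCount p p Φ (τ ^ j.val * κ) τ t =
      (Finset.univ.filter fun y : ZMod p => τ ^ (j * y + t).val * κ ^ y.val ∈ Φ).card := by
  unfold rowCount
  congr 1
  exact Finset.filter_congr fun y _ => by rw [diag_coord hτ hκ]

/-- **A `τ`-stable type is equidistributed over the cosets of every `⟨τʲκ⟩`** (each such coset is a transversal of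
`⟨τ⟩`). [cite: Dodson1987, Prop. 4.4 (2)(b)] -/
theorem hasConstantRows_diag_of_isStableUnder (hp2 : p ≠ 2) (hτ : orderOf τ = p) (hκ : orderOf κ = p)
    (hτκ : κ ∉ Subgroup.zpowers τ) (hcard : Fintype.card G = 2 * p ^ 2) (h : IsCMTypeWith ρ (Φ : Set G))
    (hst : IsStableUnder Φ τ) (j : ZMod p) :
    haveI : NeZero p := ⟨hp.out.ne_zero⟩
    HasConstantRows p p Φ (τ ^ j.val * κ) τ := by
  haveI : NeZero p := ⟨hp.out.ne_zero⟩
  haveI : Fact (1 < p) := ⟨hp.out.one_lt⟩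
  have H := (isStableUnder_iff_coord hp2 hτ hκ hτκ hcard h τ).1 hst
  intro t t'
  refine const_of_periodic (d := (1 : ZMod p)) one_ne_zero (fun s => ?_) t t'
  rw [rowCount_diag hτ hκ, rowCount_diag hτ hκ]
  congr 1
  refine Finset.filter_congr fun y _ => ?_
  rw [H (j * y + s) y, tau_mul_coord hτ, add_assoc]

/-- **A `τʲκ`-stable type is equidistributed over the cosets of `⟨τ⟩`.** [cite: Dodson1987, Prop. 4.4 (2)(b)] -/
theorem hasConstantRows_of_isStableUnder_diag (hp2 : p ≠ 2) (hτ : orderOf τ = p) (hκ : orderOf κ = p)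
    (hτκ : κ ∉ Subgroup.zpowers τ) (hcard : Fintype.card G = 2 * p ^ 2) (h : IsCMTypeWith ρ (Φ : Set G))
    (j : ZMod p) (hst : IsStableUnder Φ (τ ^ j.val * κ)) :
    haveI : NeZero p := ⟨hp.out.ne_zero⟩
    HasConstantRows p p Φ τ κ := by
  haveI : NeZero p := ⟨hp.out.ne_zero⟩
  haveI : Fact (1 < p) := ⟨hp.out.one_lt⟩
  have H := (isStableUnder_iff_coord hp2 hτ hκ hτκ hcard h (τ ^ j.val * κ)).1 hst
  intro y y'
  refine const_of_periodic (d := (1 : ZMod p)) one_ne_zero (fun b => ?_) y y'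
  unfold rowCount
  rw [← card_filter_add_eq (fun x : ZMod p => τ ^ x.val * κ ^ (b + 1).val ∈ Φ) j]
  congr 1
  refine Finset.filter_congr fun x _ => ?_
  rw [H x b, diag_mul_coord hτ hκ]

/-- **A `τʲκ`-stable type is equidistributed over the cosets of every other `⟨τʲ'κ⟩`, `j' ≠ j`.**
[cite: Dodson1987, Prop. 4.4 (2)(b)] -/
theorem hasConstantRows_diag_of_isStableUnder_diag (hp2 : p ≠ 2) (hτ : orderOf τ = p) (hκ : orderOf κ = p)
    (hτκ : κ ∉ Subgroup.zpowers τ) (hcard : Fintype.card G = 2 * p ^ 2) (h : IsCMTypeWith ρ (Φ : Set G))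
    (j : ZMod p) (hst : IsStableUnder Φ (τ ^ j.val * κ)) {j' : ZMod p} (hjj' : j' ≠ j) :
    haveI : NeZero p := ⟨hp.out.ne_zero⟩
    HasConstantRows p p Φ (τ ^ j'.val * κ) τ := by
  haveI : NeZero p := ⟨hp.out.ne_zero⟩
  have H := (isStableUnder_iff_coord hp2 hτ hκ hτκ hcard h (τ ^ j.val * κ)).1 hst
  intro t t'
  refine const_of_periodic (d := j - j') (sub_ne_zero.2 hjj'.symm) (fun s => ?_) t t'
  rw [rowCount_diag hτ hκ, rowCount_diag hτ hκ,
    ← card_filter_add_eq (fun y : ZMod p => τ ^ (j' * y + (s + (j - j'))).val * κ ^ y.val ∈ Φ) 1]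
  congr 1
  refine Finset.filter_congr fun y _ => ?_
  rw [H (j' * y + s) y, diag_mul_coord hτ hκ]
  have e1 : j' * y + s + j = j' * (y + 1) + (s + (j - j')) := by ring
  rw [e1]

omit [DecidableEq G] in
/-- **The possible stabilisers**: some `u ≠ 1` stabilises the CM type `S` iff `τ` or some `τʲκ` does — a
non-trivial stabiliser lies in `(ℤ/p)²` (an element of `ρ(ℤ/p)²` has `ρ` as a power) and generates one of the
`p + 1` subgroups of order `p` ("the four `ℤ₃²`-orbits of order `3` correspond to the four subgroups isomorphic to
`ℤ₃` in `ℤ₃²`"). [cite: Dodson1987, Prop. 4.4 (2)(b) (proof)] [cite: Hazama2003CyclicCM, Prop. 2.3] -/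
theorem exists_isStableUnder_iff (hp2 : p ≠ 2) (hτ : orderOf τ = p) (hκ : orderOf κ = p)
    (hτκ : κ ∉ Subgroup.zpowers τ) (hcard : Fintype.card G = 2 * p ^ 2) (h : IsCMTypeWith ρ (Φ : Set G)) :
    (∃ u : G, u ≠ 1 ∧ IsStableUnder Φ u) ↔
      IsStableUnder Φ τ ∨ ∃ j : ZMod p, IsStableUnder Φ (τ ^ j.val * κ) := by
  haveI : NeZero p := ⟨hp.out.ne_zero⟩
  haveI : Fact (1 < p) := ⟨hp.out.one_lt⟩
  have hτ1 : τ ≠ 1 := fun h1 => by rw [h1, orderOf_one] at hτ; exact hp.out.one_lt.ne' hτ.symm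
  constructor
  · rintro ⟨u, hu1, hu⟩
    obtain ⟨⟨x, y⟩, rfl | rfl⟩ := exists_coord hp2 hτ hκ hτκ hcard (rho_ne_one h) (rho_mul_rho h) u
    · simp only at hu hu1 ⊢
      by_cases hy : y = 0
      · -- `u = τˣ`, `x ≠ 0`: `u^{x⁻¹} = τ`
        have hx : x ≠ 0 := by
          rintro rfl
          rw [hy, ZMod.val_zero, pow_zero, pow_zero, mul_one] at hu1
          exact hu1 rfl
        left
        have hpow := hu.pow (x⁻¹).val
        rw [hy, ZMod.val_zero, pow_zero, mul_one, ← pow_mul, ← pow_val_natCast hτ, Nat.cast_mul,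
          ZMod.natCast_zmod_val, ZMod.natCast_zmod_val, mul_inv_cancel₀ hx, pow_val_one] at hpow
        exact hpow
      · -- `u = τˣκʸ`, `y ≠ 0`: `u^{y⁻¹} = τ^{x/y} κ`
        right
        refine ⟨x * y⁻¹, ?_⟩
        have hpow := hu.pow (y⁻¹).val
        rw [mul_pow, ← pow_mul, ← pow_mul] at hpow
        have heq : τ ^ (x.val * (y⁻¹).val) * κ ^ (y.val * (y⁻¹).val) = τ ^ (x * y⁻¹).val * κ := by
          rw [← pow_val_natCast hτ, ← pow_val_natCast hκ, Nat.cast_mul, Nat.cast_mul, ZMod.natCast_zmod_val,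
            ZMod.natCast_zmod_val, ZMod.natCast_zmod_val, mul_inv_cancel₀ hy, pow_val_one]
        rwa [heq] at hpow
    · -- `u = ρτˣκʸ`: `u^p = ρ` would stabilise `S`
      exfalso
      have hpow := hu.pow p
      have hτp : τ ^ p = 1 := by rw [← hτ]; exact pow_orderOf_eq_one τ
      have hκp : κ ^ p = 1 := by rw [← hκ]; exact pow_orderOf_eq_one κ
      obtain ⟨k, hk⟩ := hp.out.odd_of_ne_two hp2
      have hρp : ρ ^ p = ρ := by
        rw [hk, pow_succ, pow_mul, sq, rho_mul_rho h, one_pow, one_mul]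
      rw [mul_pow, mul_pow, ← pow_mul, ← pow_mul, pow_mul', hτp, one_pow, pow_mul', hκp, one_pow, mul_one,
        mul_one, hρp] at hpow
      have h1 := hpow 1
      have h2 := rho_mul_mem_iff h (1 : G)
      rw [mul_one] at h1 h2
      exact iff_not_self (h1.trans h2)
  · rintro (hst | ⟨j, hst⟩)
    · exact ⟨τ, hτ1, hst⟩
    · refine ⟨τ ^ j.val * κ, fun h1 => ?_, hst⟩
      have := (frame_change hτ hκ hτκ j.val).1
      rw [h1, orderOf_one] at this
      exact hp.out.one_lt.ne' this.symm

omit [DecidableEq G] in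
/-- **Primitivity criterion on `⟨ρ⟩ × (ℤ/p)²`**: no `u ≠ 1` stabilises `S` iff neither `τ` nor any `τʲκ` does
(Dodson: the `R₀`-orbit of `f` has order `p²`). [cite: Dodson1987, Prop. 4.4 (2)] [cite: Hazama2003CyclicCM, Prop. 2.3] -/
theorem forall_not_isStableUnder_iff (hp2 : p ≠ 2) (hτ : orderOf τ = p) (hκ : orderOf κ = p)
    (hτκ : κ ∉ Subgroup.zpowers τ) (hcard : Fintype.card G = 2 * p ^ 2) (h : IsCMTypeWith ρ (Φ : Set G)) :
    (∀ u : G, u ≠ 1 → ¬ IsStableUnder Φ u) ↔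
      ¬ IsStableUnder Φ τ ∧ ∀ j : ZMod p, ¬ IsStableUnder Φ (τ ^ j.val * κ) := by
  have key := exists_isStableUnder_iff hp2 hτ hκ hτκ hcard h
  constructor
  · intro H
    refine ⟨fun hst => ?_, fun j hst => ?_⟩
    · obtain ⟨u, hu1, hu⟩ := key.2 (Or.inl hst); exact H u hu1 hu
    · obtain ⟨u, hu1, hu⟩ := key.2 (Or.inr ⟨j, hst⟩); exact H u hu1 hu
  · rintro ⟨h1, h2⟩ u hu1 hu
    rcases key.1 ⟨u, hu1, hu⟩ with hst | ⟨j, hst⟩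
    · exact h1 hst
    · exact h2 j hst

open scoped Classical in
/-- **The rank of a `τ`-stable type**: `rank + (p − 1)[rows constant in `(τ, κ)`] = p + 1` — all `p` diagonal
directions are equidistributed; so `rank = p + 1`, or `2` when moreover the cosets of `⟨τ⟩` carry constant counts
(then `S ⊇ (ℤ/p)²` or `S ∩ (ℤ/p)² = ∅`: the two types induced from `⟨ρ⟩`).  Dodson's `ℤ₃²`-orbits of order `3`.
[cite: Dodson1987, Prop. 4.4 (2)(b)] [cite: Kubota1965, §4 Lemma 2] -/
theorem typeRank_add_eq_of_isStableUnder (hp2 : p ≠ 2) (hτ : orderOf τ = p) (hκ : orderOf κ = p)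
    (hτκ : κ ∉ Subgroup.zpowers τ) (hcard : Fintype.card G = 2 * p ^ 2) (h : IsCMTypeWith ρ (Φ : Set G))
    (hst : IsStableUnder Φ τ) :
    haveI : NeZero p := ⟨hp.out.ne_zero⟩
    typeRank G (Φ : Set G) + (if HasConstantRows p p Φ τ κ then p - 1 else 0) = p + 1 := by
  haveI : NeZero p := ⟨hp.out.ne_zero⟩
  have key := typeRank_add_defect_eq hp2 hτ hκ hτκ hcard h
  rw [Finset.filter_true_of_mem fun j _ => hasConstantRows_diag_of_isStableUnder hp2 hτ hκ hτκ hcard h hst j,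
    Finset.card_univ, ZMod.card] at key
  have hp1 : 1 < p := hp.out.one_lt
  have hsq : p * (p - 1) + (p + 1) = p ^ 2 + 1 := by
    obtain ⟨k, rfl⟩ := Nat.exists_eq_add_of_le hp1.le
    simp only [Nat.add_sub_cancel_left, sq]
    ring
  omega

open scoped Classical in
/-- **The rank of a `τʲκ`-stable type**: `rank + (p − 1)[constant counts on the cosets of ⟨τʲκ⟩] = p + 1` — the
`p` other directions are equidistributed; `rank = p + 1` or `2`. [cite: Dodson1987, Prop. 4.4 (2)(b)] [cite: Kubota1965, §4 Lemma 2] -/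
theorem typeRank_add_eq_of_isStableUnder_diag (hp2 : p ≠ 2) (hτ : orderOf τ = p) (hκ : orderOf κ = p)
    (hτκ : κ ∉ Subgroup.zpowers τ) (hcard : Fintype.card G = 2 * p ^ 2) (h : IsCMTypeWith ρ (Φ : Set G))
    (j : ZMod p) (hst : IsStableUnder Φ (τ ^ j.val * κ)) :
    haveI : NeZero p := ⟨hp.out.ne_zero⟩
    typeRank G (Φ : Set G) + (if HasConstantRows p p Φ (τ ^ j.val * κ) τ then p - 1 else 0) = p + 1 := by
  haveI : NeZero p := ⟨hp.out.ne_zero⟩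
  have key := typeRank_add_defect_eq hp2 hτ hκ hτκ hcard h
  rw [if_pos (hasConstantRows_of_isStableUnder_diag hp2 hτ hκ hτκ hcard h j hst)] at key
  have hp1 : 1 < p := hp.out.one_lt
  have hsq : (p - 1) * (p - 1) + (p - 1) + (p + 1) = p ^ 2 + 1 := by
    obtain ⟨k, rfl⟩ := Nat.exists_eq_add_of_le hp1.le
    simp only [Nat.add_sub_cancel_left, sq]
    ring
  -- the filter contains every `j' ≠ j`, and `j` iff the cosets of `⟨τʲκ⟩` carry constant counts
  by_cases hr : HasConstantRows p p Φ (τ ^ j.val * κ) τ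
  · rw [if_pos hr]
    have hall : (Finset.univ.filter fun j' : ZMod p => HasConstantRows p p Φ (τ ^ j'.val * κ) τ) =
        Finset.univ := by
      refine Finset.filter_true_of_mem fun j' _ => ?_
      by_cases hjj' : j' = j
      · rw [hjj']; exact hr
      · exact hasConstantRows_diag_of_isStableUnder_diag hp2 hτ hκ hτκ hcard h j hst hjj'
    rw [hall, Finset.card_univ, ZMod.card] at key
    have : p * (p - 1) = (p - 1) * (p - 1) + (p - 1) := by
      obtain ⟨k, rfl⟩ := Nat.exists_eq_add_of_le hp1.le
      simp only [Nat.add_sub_cancel_left]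
      ring
    omega
  · rw [if_neg hr, add_zero]
    have hall : (Finset.univ.filter fun j' : ZMod p => HasConstantRows p p Φ (τ ^ j'.val * κ) τ) =
        Finset.univ.erase j := by
      ext j'
      simp only [Finset.mem_filter, Finset.mem_univ, true_and, Finset.mem_erase, and_true]
      constructor
      · intro hj' hjj'; rw [hjj'] at hj'; exact hr hj'
      · intro hjj'; exact hasConstantRows_diag_of_isStableUnder_diag hp2 hτ hκ hτκ hcard h j hst hjj'
    rw [hall, Finset.card_erase_of_mem (Finset.mem_univ j), Finset.card_univ, ZMod.card] at key
    omega

open scoped Classical in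
/-- **The ranks of the imprimitive types are `p + 1` and `2`** (Dodson's orbits of order `3` on `⟨ρ⟩ × ℤ₃²`:
ranks `4` and `2`). [cite: Dodson1987, Prop. 4.4 (2)(b)] [cite: Kubota1965, §4 Lemma 2] -/
theorem typeRank_eq_or_of_exists_isStableUnder (hp2 : p ≠ 2) (hτ : orderOf τ = p) (hκ : orderOf κ = p)
    (hτκ : κ ∉ Subgroup.zpowers τ) (hcard : Fintype.card G = 2 * p ^ 2) (h : IsCMTypeWith ρ (Φ : Set G))
    (hst : ∃ u : G, u ≠ 1 ∧ IsStableUnder Φ u) :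
    typeRank G (Φ : Set G) = p + 1 ∨ typeRank G (Φ : Set G) = 2 := by
  haveI : NeZero p := ⟨hp.out.ne_zero⟩
  have hp1 : 1 < p := hp.out.one_lt
  rcases (exists_isStableUnder_iff hp2 hτ hκ hτκ hcard h).1 hst with hst | ⟨j, hst⟩
  · have key := typeRank_add_eq_of_isStableUnder hp2 hτ hκ hτκ hcard h hst
    split_ifs at key <;> omega
  · have key := typeRank_add_eq_of_isStableUnder_diag hp2 hτ hκ hτκ hcard h j hst
    split_ifs at key <;> omega

end Stabilisers

/-! ## §6 Weights prime to `p` (Dodson's Prop. 4.1 for `R₀ = ℤₚ²`, with the exact rank) -/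

section Weight

variable {G : Type*} [CommGroup G] [Fintype G] [DecidableEq G] {p : ℕ} [hp : Fact p.Prime] {ρ τ κ : G}
  {Φ : Finset G}

omit [Fintype G] in
/-- **The weight in the frame `(τʲκ, τ)` equals the weight in the frame `(τ, κ)`**: both count the points of `S`
in `(ℤ/p)²`, `#{(y, t) : (τʲκ)ʸτᵗ ∈ S} = #{(x, y) : τˣκʸ ∈ S}` (the change of coordinates `(y, t) ↦ (jy + t, y)`).
[cite: Dodson1987, Prop. 4.1 (proof)] -/
theorem card_filter_diag_eq (hτ : orderOf τ = p) (hκ : orderOf κ = p) (j : ZMod p) :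
    (Finset.univ.filter fun yt : ZMod p × ZMod p => (τ ^ j.val * κ) ^ yt.1.val * τ ^ yt.2.val ∈ Φ).card =
      (Finset.univ.filter fun xy : ZMod p × ZMod p => τ ^ xy.1.val * κ ^ xy.2.val ∈ Φ).card := by
  refine Finset.card_bij (fun yt _ => (j * yt.1 + yt.2, yt.1)) (fun yt hyt => ?_)
    (fun yt _ yt' _ hh => ?_) (fun xy hxy => ⟨(xy.2, xy.1 - j * xy.2), ?_, ?_⟩)
  · simp only [Finset.mem_filter, Finset.mem_univ, true_and] at hyt ⊢
    rwa [← diag_coord hτ hκ]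
  · simp only [Prod.mk.injEq] at hh
    obtain ⟨h1, h2⟩ := hh
    rw [h2] at h1
    exact Prod.ext h2 (add_left_cancel h1)
  · simp only [Finset.mem_filter, Finset.mem_univ, true_and] at hxy ⊢
    rwa [diag_coord hτ hκ, add_sub_cancel]
  · simp only [add_sub_cancel]

omit [Fintype G] in
/-- **A weight prime to `p` forbids equidistribution over the cosets of `⟨τ⟩`** (a common count `c` on the `p`
cosets would give `pc` points). [cite: Dodson1987, Prop. 4.1] -/
theorem not_hasConstantRows_of_not_dvd
    (hnd : ¬ p ∣ (Finset.univ.filter fun xy : ZMod p × ZMod p => τ ^ xy.1.val * κ ^ xy.2.val ∈ Φ).card) :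
    haveI : NeZero p := ⟨hp.out.ne_zero⟩
    ¬ HasConstantRows p p Φ τ κ := by
  haveI : NeZero p := ⟨hp.out.ne_zero⟩
  intro hr
  apply hnd
  rw [← sum_rowCount_eq p p Φ τ κ, Finset.sum_congr rfl fun y _ => hr y 0, Finset.sum_const, Finset.card_univ,
    ZMod.card, smul_eq_mul]
  exact Dvd.intro _ rfl

omit [Fintype G] in
/-- **… and over the cosets of every `⟨τʲκ⟩`.** [cite: Dodson1987, Prop. 4.1] -/
theorem not_hasConstantRows_diag_of_not_dvd (hτ : orderOf τ = p) (hκ : orderOf κ = p)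
    (hnd : ¬ p ∣ (Finset.univ.filter fun xy : ZMod p × ZMod p => τ ^ xy.1.val * κ ^ xy.2.val ∈ Φ).card)
    (j : ZMod p) :
    haveI : NeZero p := ⟨hp.out.ne_zero⟩
    ¬ HasConstantRows p p Φ (τ ^ j.val * κ) τ := by
  haveI : NeZero p := ⟨hp.out.ne_zero⟩
  intro hr
  apply hnd
  rw [← card_filter_diag_eq hτ hκ j, ← sum_rowCount_eq p p Φ (τ ^ j.val * κ) τ,
    Finset.sum_congr rfl fun t _ => hr t 0, Finset.sum_const, Finset.card_univ, ZMod.card, smul_eq_mul]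
  exact Dvd.intro _ rfl

/-- **Dodson's Prop. 4.1 for `R₀ = ℤₚ × ℤₚ`, with the exact rank**: a CM type of `⟨ρ⟩ × (ℤ/p)²` whose weight
`#{S ∩ (ℤ/p)²}` is prime to `p` is NONDEGENERATE, `rank = p² + 1` ("the type defined by `f` is nondegenerate
whenever weight(`f`) is relatively prime to `3`" — here no primitivity hypothesis is needed: every vanishing of an
odd character is an equidistribution, which forces `p ∣` weight; the tree's `PrimePowerBlockNondegenerate` proves
Prop. 4.1 for every transitive group of prime-power degree by a different route). [cite: Dodson1987, Prop. 4.1] -/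
theorem typeRank_eq_of_not_dvd (hp2 : p ≠ 2) (hτ : orderOf τ = p) (hκ : orderOf κ = p)
    (hτκ : κ ∉ Subgroup.zpowers τ) (hcard : Fintype.card G = 2 * p ^ 2) (h : IsCMTypeWith ρ (Φ : Set G))
    (hnd : ¬ p ∣ (Finset.univ.filter fun xy : ZMod p × ZMod p => τ ^ xy.1.val * κ ^ xy.2.val ∈ Φ).card) :
    typeRank G (Φ : Set G) = p ^ 2 + 1 :=
  (typeRank_eq_iff hp2 hτ hκ hτκ hcard h).2
    ⟨not_hasConstantRows_of_not_dvd hnd, not_hasConstantRows_diag_of_not_dvd hτ hκ hnd⟩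

end Weight

/-! ## §7 Dimension `9` as printed: `⟨ρ⟩ × ℤ₃²` (Dodson 1987, Example 4.3, Prop. 4.4 (2)) -/

section Nine

variable {G : Type*} [CommGroup G] [Fintype G] [DecidableEq G] {ρ τ κ : G} {Φ : Finset G}

open scoped Classical in
/-- **`⟨ρ⟩ × ℤ₃²`: `rank(f) + 2·t(f) = 10`**, `t(f) ≤ 4` the number of subgroups `ℤ₃ ⊂ ℤ₃²` over whose cosets the
type is equidistributed (Kubota's count on Dodson's second minimal group of degree `9`, Example 4.3).
[cite: Dodson1987, Example 4.3 and Prop. 4.4 (2)] [cite: Kubota1965, §4 Lemma 2] -/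
theorem typeRank_add_defect_eq_nine (hτ : orderOf τ = 3) (hκ : orderOf κ = 3) (hτκ : κ ∉ Subgroup.zpowers τ)
    (hcard : Fintype.card G = 18) (h : IsCMTypeWith ρ (Φ : Set G)) :
    typeRank G (Φ : Set G) +
        2 * ((if HasConstantRows 3 3 Φ τ κ then 1 else 0) +
          (Finset.univ.filter fun j : ZMod 3 => HasConstantRows 3 3 Φ (τ ^ j.val * κ) τ).card) = 10 := by
  have key := typeRank_add_defect_eq (p := 3) (by norm_num) hτ hκ hτκ (by rw [hcard]; norm_num) h
  split_ifs at key ⊢ <;> omega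

open scoped Classical in
/-- **Prop. 4.4 (2)(a), the mechanism: a type of `⟨ρ⟩ × ℤ₃²` equidistributed over the cosets of EXACTLY ONE
`ℤ₃ ⊂ ℤ₃²` has rank `8`** ("the orbits of order `9` give types with rank(`f`) `= 8`": a weight-`3` type which is not
a coset of a `ℤ₃` is a transversal of exactly one of the four subgroups). [cite: Dodson1987, Prop. 4.4 (2)(a)] -/
theorem typeRank_eq_eight_of_unique_direction (hτ : orderOf τ = 3) (hκ : orderOf κ = 3)
    (hτκ : κ ∉ Subgroup.zpowers τ) (hcard : Fintype.card G = 18) (h : IsCMTypeWith ρ (Φ : Set G))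
    (hone : haveI : NeZero 3 := ⟨by norm_num⟩
      (if HasConstantRows 3 3 Φ τ κ then 1 else 0) +
        (Finset.univ.filter fun j : ZMod 3 => HasConstantRows 3 3 Φ (τ ^ j.val * κ) τ).card = 1) :
    typeRank G (Φ : Set G) = 8 :=
  typeRank_eq_of_unique_direction (p := 3) (by norm_num) hτ hκ hτκ (by rw [hcard]; norm_num) h hone

/-- **Nondegeneracy on `⟨ρ⟩ × ℤ₃²`**: `rank = 10` iff the type is equidistributed over the cosets of none of the
four `ℤ₃ ⊂ ℤ₃²`. [cite: Dodson1987, Prop. 4.1 and Prop. 4.4 (2)] -/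
theorem typeRank_eq_ten_iff (hτ : orderOf τ = 3) (hκ : orderOf κ = 3) (hτκ : κ ∉ Subgroup.zpowers τ)
    (hcard : Fintype.card G = 18) (h : IsCMTypeWith ρ (Φ : Set G)) :
    typeRank G (Φ : Set G) = 10 ↔
      ¬ HasConstantRows 3 3 Φ τ κ ∧ ∀ j : ZMod 3, ¬ HasConstantRows 3 3 Φ (τ ^ j.val * κ) τ :=
  typeRank_eq_iff (p := 3) (by norm_num) hτ hκ hτκ (by rw [hcard]; norm_num) h

/-- **Prop. 4.1 for `R₀ = ℤ₃²` as printed**: "the type defined by `f` is nondegenerate whenever weight(`f`) is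
relatively prime to `3`" — `rank = 10`. [cite: Dodson1987, Prop. 4.1] -/
theorem typeRank_eq_ten_of_not_dvd (hτ : orderOf τ = 3) (hκ : orderOf κ = 3) (hτκ : κ ∉ Subgroup.zpowers τ)
    (hcard : Fintype.card G = 18) (h : IsCMTypeWith ρ (Φ : Set G))
    (hnd : ¬ 3 ∣ (Finset.univ.filter fun xy : ZMod 3 × ZMod 3 => τ ^ xy.1.val * κ ^ xy.2.val ∈ Φ).card) :
    typeRank G (Φ : Set G) = 10 :=
  typeRank_eq_of_not_dvd (p := 3) (by norm_num) hτ hκ hτκ (by rw [hcard]; norm_num) h hnd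

/-- **The imprimitive types of `⟨ρ⟩ × ℤ₃²` (the `ℤ₃²`-orbits of order `3`) have rank `4` or `2`.**
[cite: Dodson1987, Prop. 4.4 (2)(b)] [cite: Kubota1965, §4 Lemma 2] -/
theorem typeRank_eq_or_of_exists_isStableUnder_nine (hτ : orderOf τ = 3) (hκ : orderOf κ = 3)
    (hτκ : κ ∉ Subgroup.zpowers τ) (hcard : Fintype.card G = 18) (h : IsCMTypeWith ρ (Φ : Set G))
    (hst : ∃ u : G, u ≠ 1 ∧ IsStableUnder Φ u) :
    typeRank G (Φ : Set G) = 4 ∨ typeRank G (Φ : Set G) = 2 :=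
  typeRank_eq_or_of_exists_isStableUnder (p := 3) (by norm_num) hτ hκ hτκ (by rw [hcard]; norm_num) h hst

end Nine

end ElemSq

end CyclicCMType

end Literature.NumberTheory.ComplexMultiplication
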